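import Literature.NumberTheory.EllipticCurves.CyclotomicZpExtension
import Mathlib.RingTheory.ZMod.UnitsCyclic
import Literature.NumberTheory.EllipticCurves.PadicSigmaLogFirstOrderProofs
import Mathlib.RingTheory.Polynomial.Cyclotomic.Eval
import Mathlib.Data.Fintype.Pigeonhole
import Literature.NumberTheory.EllipticCurves.Greenberg1999.ControlLocalKernelAtPMultiplicative
import Literature.NumberTheory.EllipticCurves.Greenberg1999.LocalCyclotomicTowerLayerProofs
import Literature.NumberTheory.EllipticCurves.Greenberg1999.SplitMultiplicativeLocalTowerKernelPTorsionProofs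
import Literature.NumberTheory.EllipticCurves.Greenberg1999.LocalTowerTransferCoinvariantCocyclesProofs
import Literature.NumberTheory.EllipticCurves.Greenberg1999.SplitMultiplicativeLocalTowerKernelOrderProofs
import HarnessLib

/-!
# `sec3_natCard_localTowerKerPrimary_splitMultiplicative_rat` HOLDS — the `p`-primary local tower kernel at a split multiplicative prime has order `p^e`, `e + ord_p(2p) = ord_p(log_p q_E)`, at every layer (Greenberg 1999 §3; re-homed proofs, exact-order cone file 3 of 3)

Family `bsd` material RE-HOMED into `Literature/` by the Hodge foundations lane (`lit-hodgefound`, seat p20, generation 35),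
file 3 of 3 of the EXACT-ORDER cone (continuing `LocalCyclotomicTowerLayerProofs` / `SplitMultiplicativeLocalTowerKernelPTorsionProofs`, whose
twelve modules are imported, not repeated): verbatim ports, in dependency order and each with its original module docstring (Parts 1–8), of the
cell `bsd-2adic` TOWER-road modules (route `ByReductionTypeAtTwo`, crux `MultUpperHalfAtTwo`, item stmt-BirchSwinnertonDyer-19922)
ByReductionTypeAtTwoMultTowerSplitExactOddUnits, ByReductionTypeAtTwoMultTowerSplitExactOddDepth, ByReductionTypeAtTwoMultTowerSplitExactOddCyclotomic, ByReductionTypeAtTwoMultTowerSplitExactOddCyclotomicNorm, ByReductionTypeAtTwoMultTowerSplitExactOddNormGroup, ByReductionTypeAtTwoMultTowerSplitExactOddNonNorm, ByReductionTypeAtTwoMultTowerSplitExactOddCount, ByReductionTypeAtTwoMultTowerSplitExactOdd (under `Summits/BirchSwinnertonDyer/BirchSwinnertonDyer/Theorems/`, resp. `Summits/BirchSwinnertonDyer/Rank1Residual/Additive/`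
for `LocalZpExtension` / `LocalTowerKernelPrimaryExact`), namespaces re-rooted `Summit.BirchSwinnertonDyer.BirchSwinnertonDyer.Theorems.{MultTowerNS2,
MultTowerSP1, MultTowerSplitExact, MultTowerSplitOrder, GoodOrdTower}` ↦ `Literature.NumberTheory.EllipticCurves.Greenberg1999.{…}` and
`Summit.BirchSwinnertonDyer.Rank1Residual.Additive` ↦ `Literature.NumberTheory.EllipticCurves.Greenberg1999.Rank1ResidualAdditive`; theorems only
(no definition, no named fact), imports Literature/Mathlib only; all `[folklore]` helpers privatised — Part 0 re-proves privately, verbatim with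
their scope context, the `[folklore]` helpers of the earlier files that this file's parts use (they are private there); `open` commands of shadowed
Mathlib roots made `_root_`-explicit; the originals' section-wide instance declaration for `AdicCompletion.nontriviallyNormedField` is dropped (the one proof that
needs it, `MultTowerSplitOrder.exists_tateUniformisation_tateJ` of file 1, now binds it with a proof-local `letI`).  CONTENT (odd `p`): units, depth, the cyclotomic layers and their norms, norm groups, non-norm elements, the count, and the assembly over all primes (Part 8; apex renamed `MultTowerSplitExact.sec3_natCard_localTowerKerPrimary_splitMultiplicative_rat_allPrimes`, Part 9 = the FULLY-QUALIFIED discharge of record).  Summits-side twin: `Summit.BirchSwinnertonDyer.BirchSwinnertonDyer.Theorems.MultTowerSplitExact.sec3_natCard_localTowerKerPrimary_splitMultiplicative_rat_holds`.  WHY: the three files complete, inside `Literature/`, the only proof in the tree of the Literature named fact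
`NumberTheory.EllipticCurves.Greenberg1999.sec3_natCard_localTowerKerPrimary_splitMultiplicative_rat` (Greenberg LNM 1716 §3, PDF pp. 90–93: for
`W/ℚ` globally minimal with a Tate parameter datum at `p` and `log_p q_E ≠ 0`, `κ` cyclotomic, `v ∋ p`, there is `e` with `e + ord_p(2p) =
ord_p(log_p q_E)` such that at EVERY layer the `p`-primary local tower kernel `𝒦_{v,n}[p^∞]` is finite of order `p^e`), which `Literature/`
could not import.  The Summits originals stay in place (transitional duplication; cited here).  Honest framing of the originals stands: nothing is
booked, BSD is not proved by any of this.
-/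

noncomputable section

/-! ## Part 0 — 10 `[folklore]` helper(s) of the earlier tower files (private there), re-proved privately (verbatim, with their scope context) -/

section Part0

-- from `ByReductionTypeAtTwoMultTowerNS2LocalLayerField`
set_option autoImplicit false
section
namespace Literature.NumberTheory.EllipticCurves.Greenberg1999.MultTowerNS2
open _root_.NumberField _root_.IsDedekindDomain _root_.Field Literature.NumberTheory.EllipticCurves
  Literature.NumberTheory.GaloisRepresentations
universe u
/-- `localSubgroup H E = res⁻¹(H)` is open in `Γ_E` when `H` is open in `Γ_K` (the restriction `resGal E` is
continuous). [folklore] -/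
private theorem isOpen_localSubgroup {K : Type u} [Field K] (H : Subgroup (absoluteGaloisGroup K))
    (hH : IsOpen (H : Set (absoluteGaloisGroup K))) (E : Type u) [Field E] [Algebra K E] :
    IsOpen (localSubgroup H E : Set (absoluteGaloisGroup E)) :=
  hH.preimage (resGal (K := K) E).continuous_toFun
end Literature.NumberTheory.EllipticCurves.Greenberg1999.MultTowerNS2
end

-- from `ByReductionTypeAtTwoMultTowerNS2LayerNormGroup`
set_option autoImplicit false
section
open scoped _root_.Classical _root_.IntermediateField
namespace Literature.NumberTheory.EllipticCurves.Greenberg1999.MultTowerNS2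
open _root_.NumberField _root_.IsDedekindDomain _root_.Field _root_.PadicInt Literature.NumberTheory.EllipticCurves
  Literature.NumberTheory.GaloisRepresentations
/-- Two subgroups `T ≤ S` of the same finite index are equal. [folklore] -/
private theorem subgroup_eq_of_le_of_index_eq {G : Type*} [Group G] {T S : Subgroup G} (h : T ≤ S)
    (hidx : T.index = S.index) (h0 : S.index ≠ 0) : T = S := by
  refine le_antisymm h ?_
  have hmul := Subgroup.relIndex_mul_index h
  rw [hidx] at hmul
  have hrel : T.relIndex S = 1 := by
    have : T.relIndex S * S.index = 1 * S.index := by rw [hmul, one_mul]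
    exact mul_right_cancel₀ h0 this
  exact Subgroup.relIndex_eq_one.mp hrel
end Literature.NumberTheory.EllipticCurves.Greenberg1999.MultTowerNS2
end

-- from `ByReductionTypeAtTwoMultTowerNS2TwistedTateAlgebra`
set_option autoImplicit false
section
open scoped _root_.Classical _root_.IntermediateField
namespace Literature.NumberTheory.EllipticCurves.Greenberg1999.MultTowerNS2
open _root_.NumberField _root_.IsDedekindDomain _root_.Field _root_.PadicInt Literature.NumberTheory.EllipticCurves
  Literature.NumberTheory.GaloisRepresentations
variable {K : Type*} [Field K]
/-- `N(w₁ w₂) = N(w₁) N(w₂)`. [folklore] -/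
private theorem prod_smul_mul (g : absoluteGaloisGroup K) (m : ℕ) (w₁ w₂ : AlgebraicClosure K) :
    (∏ i ∈ Finset.range m, (g ^ i) • (w₁ * w₂)) =
      (∏ i ∈ Finset.range m, (g ^ i) • w₁) * ∏ i ∈ Finset.range m, (g ^ i) • w₂ := by
  rw [← Finset.prod_mul_distrib]
  exact Finset.prod_congr rfl fun i _ ↦ smul_mul' _ _ _
end Literature.NumberTheory.EllipticCurves.Greenberg1999.MultTowerNS2
end

-- from `ByReductionTypeAtTwoMultTowerNS2TwistedTateAlgebra`
set_option autoImplicit false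
section
open scoped _root_.Classical _root_.IntermediateField
namespace Literature.NumberTheory.EllipticCurves.Greenberg1999.MultTowerNS2
open _root_.NumberField _root_.IsDedekindDomain _root_.Field _root_.PadicInt Literature.NumberTheory.EllipticCurves
  Literature.NumberTheory.GaloisRepresentations
variable {K : Type*} [Field K]
/-- `N(w⁻¹) = N(w)⁻¹`. [folklore] -/
private theorem prod_smul_inv (g : absoluteGaloisGroup K) (m : ℕ) (w : AlgebraicClosure K) :
    (∏ i ∈ Finset.range m, (g ^ i) • w⁻¹) = (∏ i ∈ Finset.range m, (g ^ i) • w)⁻¹ := by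
  rw [← Finset.prod_inv_distrib]
  exact Finset.prod_congr rfl fun i _ ↦ smul_inv'' _ _
end Literature.NumberTheory.EllipticCurves.Greenberg1999.MultTowerNS2
end

-- from `ByReductionTypeAtTwoMultTowerNS2TwistedTateAlgebra`
set_option autoImplicit false
section
open scoped _root_.Classical _root_.IntermediateField
namespace Literature.NumberTheory.EllipticCurves.Greenberg1999.MultTowerNS2
open _root_.NumberField _root_.IsDedekindDomain _root_.Field _root_.PadicInt Literature.NumberTheory.EllipticCurves
  Literature.NumberTheory.GaloisRepresentations
variable {K : Type*} [Field K]
/-- `N_m(g w) = N_m(w)` when `g^m w = w`. [folklore] -/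
private theorem prod_smul_smul_eq (g : absoluteGaloisGroup K) (m : ℕ) {w : AlgebraicClosure K} (hw : (g ^ m) • w = w) :
    (∏ i ∈ Finset.range m, (g ^ i) • (g • w)) = ∏ i ∈ Finset.range m, (g ^ i) • w := by
  have h : ∀ i, (g ^ i) • (g • w) = (g ^ (i + 1)) • w := fun i ↦ by rw [← mul_smul, ← pow_succ]
  simp_rw [h]
  by_cases hw0 : w = 0
  · simp [hw0]
  -- `(∏_{i<m} g^{i+1} w) · g^0 w = ∏_{i<m+1} g^i w = (∏_{i<m} g^i w) · g^m w`
  have h1 := Finset.prod_range_succ' (fun i ↦ (g ^ i) • w) m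
  rw [Finset.prod_range_succ, hw, pow_zero, one_smul] at h1
  exact mul_right_cancel₀ hw0 h1.symm
end Literature.NumberTheory.EllipticCurves.Greenberg1999.MultTowerNS2
end

-- from `ByReductionTypeAtTwoMultTowerNS2TwistedTateAlgebra`
set_option autoImplicit false
section
open scoped _root_.Classical _root_.IntermediateField
namespace Literature.NumberTheory.EllipticCurves.Greenberg1999.MultTowerNS2
open _root_.NumberField _root_.IsDedekindDomain _root_.Field _root_.PadicInt Literature.NumberTheory.EllipticCurves
  Literature.NumberTheory.GaloisRepresentations
variable {K : Type*} [Field K]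
/-- `N_m` of a `g`-fixed element is its `m`-th power. [folklore] -/
private theorem prod_smul_eq_pow_of_smul_eq (g : absoluteGaloisGroup K) (m : ℕ) {w : AlgebraicClosure K} (hw : g • w = w) :
    (∏ i ∈ Finset.range m, (g ^ i) • w) = w ^ m := by
  have h : ∀ i, (g ^ i) • w = w := fun i ↦ by
    induction i with
    | zero => rw [pow_zero, one_smul]
    | succ i ih => rw [pow_succ, mul_smul, hw, ih]
  simp_rw [h]
  rw [Finset.prod_const, Finset.card_range]
end Literature.NumberTheory.EllipticCurves.Greenberg1999.MultTowerNS2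
end

-- from `ByReductionTypeAtTwoMultTowerNS2TwistedTateAlgebra`
set_option autoImplicit false
section
open scoped _root_.Classical _root_.IntermediateField
namespace Literature.NumberTheory.EllipticCurves.Greenberg1999.MultTowerNS2
open _root_.NumberField _root_.IsDedekindDomain _root_.Field _root_.PadicInt Literature.NumberTheory.EllipticCurves
  Literature.NumberTheory.GaloisRepresentations
variable {K : Type*} [Field K]
/-- `g^m N_m(w) = N_m(w)` when `g^m w = w`. [folklore] -/
private theorem pow_smul_prod_smul_eq (g : absoluteGaloisGroup K) (m : ℕ) {w : AlgebraicClosure K} (hw : (g ^ m) • w = w) :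
    (g ^ m) • (∏ i ∈ Finset.range m, (g ^ i) • w) = ∏ i ∈ Finset.range m, (g ^ i) • w := by
  rw [Finset.smul_prod']
  refine Finset.prod_congr rfl fun i _ ↦ ?_
  rw [← mul_smul, ← pow_add, add_comm, pow_add, mul_smul, hw]
end Literature.NumberTheory.EllipticCurves.Greenberg1999.MultTowerNS2
end

-- from `ByReductionTypeAtTwoMultTowerSplitTowerAlgebra`
set_option autoImplicit false
section
open scoped _root_.Classical _root_.IntermediateField
universe u
namespace Literature.NumberTheory.EllipticCurves.Greenberg1999.MultTowerSP1
open _root_.NumberField _root_.IsDedekindDomain _root_.Field _root_.PadicInt Literature.NumberTheory.EllipticCurves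
  Literature.NumberTheory.GaloisRepresentations
variable {p : ℕ} [Fact p.Prime] {κ : ZpExtension ℚ p}
section Orbit
variable {K : Type*} [Field K]
/-- `N_{mk}(w) = N_m(w)^k` when `g^m w = w` (splitting the range `[0, mk)` into `k` blocks of length `m`, each with
product `g^{mj} N_m(w) = N_m(w)`). [folklore] -/
private theorem prod_smul_range_mul_eq_pow (g : absoluteGaloisGroup K) (m : ℕ) {w : AlgebraicClosure K}
    (hw : (g ^ m) • w = w) (k : ℕ) :
    (∏ i ∈ Finset.range (m * k), (g ^ i) • w) = (∏ i ∈ Finset.range m, (g ^ i) • w) ^ k := by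
  have hfix : ∀ j : ℕ, (g ^ (m * j)) • (∏ i ∈ Finset.range m, (g ^ i) • w) = ∏ i ∈ Finset.range m, (g ^ i) • w := by
    intro j
    induction j with
    | zero => rw [mul_zero, pow_zero, one_smul]
    | succ j ih => rw [Nat.mul_succ, pow_add, mul_smul, MultTowerNS2.pow_smul_prod_smul_eq g m hw, ih]
  induction k with
  | zero => rw [mul_zero, Finset.prod_range_zero, pow_zero]
  | succ k ih =>
    rw [Nat.mul_succ, Finset.prod_range_add, ih, pow_succ]
    congr 1
    rw [← hfix k, Finset.smul_prod']
    exact Finset.prod_congr rfl fun i _ ↦ by rw [pow_add, mul_smul]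
end Orbit
end Literature.NumberTheory.EllipticCurves.Greenberg1999.MultTowerSP1
end

-- from `ByReductionTypeAtTwoMultTowerSplitOrderPrelims`
set_option autoImplicit false
section
open scoped _root_.Classical
namespace Literature.NumberTheory.EllipticCurves.Greenberg1999.MultTowerSplitOrder
open _root_.NumberField _root_.IsDedekindDomain _root_.Field _root_.WeierstrassCurve _root_.PadicInt _root_.Rat.HeightOneSpectrum
  Literature.NumberTheory.EllipticCurves Literature.NumberTheory.GaloisRepresentations
  Literature.NumberTheory.EllipticCurves.Greenberg1999.MultTowerNS2
/-- Split multiplicative reduction at the rational prime `p` gives it at the place `v ∋ p` (Mathlib's `ℚ_v ≃ ℚ_p`;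
the tree's `hasSplitMultiplicativeReductionAtPrime_iff_hasSplitMultiplicativeReductionAt`). [folklore] -/
private theorem hasSplitMultiplicativeReductionAt_of_atPrime (W : WeierstrassCurve ℚ) [W.IsElliptic] {p : ℕ} [Fact p.Prime]
    (v : HeightOneSpectrum (𝓞 ℚ)) (hv : ((p : ℕ) : 𝓞 ℚ) ∈ v.asIdeal) (h : W.HasSplitMultiplicativeReductionAtPrime p) :
    W.HasSplitMultiplicativeReductionAt v := by
  obtain rfl : ((primesEquiv v : Nat.Primes) : ℕ) = p := primesEquiv_eq_of_natCast_mem v (Fact.out) hv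
  exact (hasSplitMultiplicativeReductionAtPrime_iff_hasSplitMultiplicativeReductionAt W v).mp h
end Literature.NumberTheory.EllipticCurves.Greenberg1999.MultTowerSplitOrder
end

-- from `ByReductionTypeAtTwoMultTowerSplitOrderPrelims`
set_option autoImplicit false
section
open scoped _root_.Classical
namespace Literature.NumberTheory.EllipticCurves.Greenberg1999.MultTowerSplitOrder
open _root_.NumberField _root_.IsDedekindDomain _root_.Field _root_.WeierstrassCurve _root_.PadicInt _root_.Rat.HeightOneSpectrum
  Literature.NumberTheory.EllipticCurves Literature.NumberTheory.GaloisRepresentations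
  Literature.NumberTheory.EllipticCurves.Greenberg1999.MultTowerNS2
/-- **A ring isomorphism `ℚ_v ≃ ℚ_p` (`v ∋ p`) carrying every local Tate parameter to THE Tate parameter of any
`TateParameterData` at `p`** (Mathlib's `padicEquiv v`, BRICK S3 `padicEquiv_eq_tateParameter`). [folklore] -/
private theorem exists_ringEquiv_tateParameter (p : ℕ) [Fact p.Prime] (v : HeightOneSpectrum (𝓞 ℚ))
    (hv : ((p : ℕ) : 𝓞 ℚ) ∈ v.asIdeal) :
    ∃ e : v.adicCompletion ℚ ≃+* ℚ_[p], ∀ (W : WeierstrassCurve ℚ) [W.IsElliptic] (q : v.adicCompletion ℚ),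
      q ≠ 0 → ‖q‖ < 1 → tateJ q = algebraMap ℚ (v.adicCompletion ℚ) W.j →
        ∀ Dq : TateParameterData W p, e q = Dq.q := by
  obtain rfl : ((primesEquiv v : Nat.Primes) : ℕ) = p := primesEquiv_eq_of_natCast_mem v (Fact.out) hv
  exact ⟨(adicCompletion.padicEquiv (R := 𝓞 ℚ) v).toAlgEquiv.toRingEquiv,
    fun W _ q hq0 hq hqj Dq ↦ padicEquiv_eq_tateParameter W v hq0 hq hqj Dq⟩
end Literature.NumberTheory.EllipticCurves.Greenberg1999.MultTowerSplitOrder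
end

end Part0

/-!
## Part 1 — port of `Summits/BirchSwinnertonDyer/BirchSwinnertonDyer/Theorems/ByReductionTypeAtTwoMultTowerSplitExactOddUnits.lean`

# Route `ByReductionTypeAtTwo`, crux `MultUpperHalfAtTwo` (item stmt-BirchSwinnertonDyer-19922), TOWER road, SPLIT rows:
# the EXACT order of the local tower kernel at a split multiplicative prime, part 4 (ODD `p`) — `p`-adic units:
# `1 + p^{m+1}ℤ_p ⊆ (ℤ_pˣ)^{p^m}` and the subgroup `T_m = ⟨p⟩·{w : w^{p−1} ≡ 1 (mod p^{m+1})}` of `ℚ_pˣ`, index `≤ p^m`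

HONEST FRAMING (cell `bsd-2adic`, run/shared/lean/pub/bsd-2adic/, seat `bsd-2adic-tower-1` GEN 27, HUMAN RULINGS
D-0036 / D-0054 / D-0074): TOOL theorems only (no definition, no named fact, no `sorry`); closes nothing by itself;
nothing booked; BSD is not proved by any of this. First ODD-`p` module towards the `∀ p` named fact
`hSP = Greenberg1999.sec3_natCard_localTowerKerPrimary_splitMultiplicative_rat` (Greenberg, LNM 1716, §3 pp. 92–93), whose
`p = 2` clause is `MultTowerSplitExact.sec3_natCard_localTowerKerPrimary_splitMultiplicative_two` (part 3). The odd-`p` road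
is the same as at `p = 2` (parts 1–3 + seat bsd-2adic-mult GEN 13's count), with the norm group of the `m`-th local layer
`F_m` of the cyclotomic `ℤ_p`-tower `N(F_mˣ) = ⟨p⟩ · μ_{p−1} · (1 + p^{m+1}ℤ_p) = {x : (unit part of x)^{p−1} ≡ 1 (mod p^{m+1})}`
in place of GEN 9's BRICK 14 `⟨2⟩·±(1 + 2^{m+2}ℤ₂)`. This file is the `p`-adic-units half of that identification (the odd-`p`
analogue of GEN 9's BRICK 12 `…MultTowerNS2TwoAdicUnits.lean`):

* `exists_units_pow_prime_pow_eq_of_toZModPow_eq_one` — **`1 + p^{m+1}ℤ_p ⊆ (ℤ_pˣ)^{p^m}`** (odd `p`): `u ≡ 1 (mod p^{m+1})`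
  is `(1+p)^x` with `‖x‖ ≤ p^{−m}` (the tree's `PadicOneUnits.oneAddPow` / `exists_oneAddPow_eq` / `norm_oneAddPow_sub_one`,
  Serre *Cours d'arithmétique* II §3), so `u = ((1+p)^y)^{p^m}`;
* `exists_eq_prime_zpow_mul_units`, `prime_zpow_mul_units_inj` — `ℚ_pˣ = p^ℤ × ℤ_pˣ`;
* `exists_subgroup_oddLayerNorm` — the subgroup `T_m = {p^j·w : w ∈ ℤ_pˣ, w^{p−1} ≡ 1 (mod p^{m+1})}` of `ℚ_pˣ` exists and
  has index `≤ p^m` (kernel of `ℚ_pˣ → ℤ_pˣ → (ℤ/p^{m+1})ˣ —(·)^{p−1}→ (ℤ/p^{m+1})ˣ`; the image has at most `p^m` elements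
  because `(ℤ/p^{m+1})ˣ` is cyclic of order `(p−1)p^m` — Mathlib `ZMod.isCyclic_units_of_prime_pow` — so the `(p−1)`-th
  powers are killed by `p^m` and `#{a : a^{p^m} = 1} ≤ p^m`, `IsCyclic.card_pow_eq_one_le`).

References: J.-P. Serre, *A Course in Arithmetic*, Ch. II §3.2; J. Neukirch, *ANT* II (5.7), V (1.1); R. Greenberg, LNM 1716
§3 pp. 92–93; cell memo NOTE-HNS2-KERNEL-GEN27.md (Stage D plan).
-/

section Part1

set_option autoImplicit false

open scoped _root_.Classical

namespace Literature.NumberTheory.EllipticCurves.Greenberg1999.MultTowerSplitExact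

open _root_.PadicInt Literature.NumberTheory.EllipticCurves.PadicOneUnits

variable {p : ℕ} [hp : Fact p.Prime]

/-! ### `1 + p^{m+1}ℤ_p ⊆ (ℤ_pˣ)^{p^m}` for odd `p` -/

/-- **`1 + p^{m+1}ℤ_p ⊆ (ℤ_pˣ)^{p^m}` (odd `p`).** If `u ≡ 1 (mod p^{m+1})` then `u = c^{p^m}` for a unit `c`: `u = (1+p)^x`
with `‖x‖·‖p‖ = ‖u − 1‖ ≤ p^{−(m+1)}`, so `x = p^m y` and `u = ((1+p)^y)^{p^m}`. [cite: Serre1973, Ch. II §3.2 Prop. 8] -/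
theorem exists_units_pow_prime_pow_eq_of_toZModPow_eq_one (hp2 : p ≠ 2) (m : ℕ) {u : ℤ_[p]}
    (hu : toZModPow (m + 1) u = 1) : ∃ c : ℤ_[p]ˣ, ((c : ℤ_[p])) ^ p ^ m = u := by
  have hp3 : 3 ≤ p := by
    have h2 := hp.out.two_le
    omega
  have he : 0 + 3 ≤ p * (0 + 1) := by omega
  -- `‖u − 1‖ ≤ p^{−(m+1)}`
  have hn : ‖u - 1‖ ≤ (p : ℝ) ^ (-(((m + 1 : ℕ) : ℤ))) := by
    have h : u - 1 ∈ Ideal.span {(p : ℤ_[p]) ^ (m + 1)} := by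
      rw [← ker_toZModPow, RingHom.mem_ker, map_sub, hu, map_one, sub_self]
    exact (norm_le_pow_iff_mem_span_pow _ _).mpr h
  have hp0 : (0 : ℝ) < p := by exact_mod_cast hp.out.pos
  have hp1 : (1 : ℝ) ≤ p := by exact_mod_cast hp.out.one_lt.le
  have hu1 : ‖u - 1‖ ≤ ‖(p : ℤ_[p]) ^ (0 + 1)‖ := by
    rw [zero_add, pow_one, PadicInt.norm_p, ← zpow_neg_one]
    exact hn.trans (zpow_le_zpow_right₀ hp1 (by omega))
  obtain ⟨x, hx⟩ := exists_oneAddPow_eq 0 he hu1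
  -- `‖x‖ ≤ p^{−m}`
  have hxn : ‖x‖ * ‖(p : ℤ_[p]) ^ (0 + 1)‖ = ‖u - 1‖ := by rw [← norm_oneAddPow_sub_one 0 he x, hx]
  rw [zero_add, pow_one, PadicInt.norm_p] at hxn
  have hxle : ‖x‖ ≤ (p : ℝ) ^ (-(m : ℤ)) := by
    have h1 : ‖x‖ = ‖u - 1‖ * p := by
      field_simp at hxn
      linarith [hxn]
    rw [h1]
    calc ‖u - 1‖ * p ≤ (p : ℝ) ^ (-(((m + 1 : ℕ) : ℤ))) * p := by gcongr
      _ = (p : ℝ) ^ (-(m : ℤ)) := by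
        rw [show (-(((m + 1 : ℕ) : ℤ))) = -(m : ℤ) + (-1) by push_cast; ring, zpow_add₀ hp0.ne', zpow_neg_one]
        field_simp
  have hxm : x ∈ Ideal.span {(p : ℤ_[p]) ^ m} := (norm_le_pow_iff_mem_span_pow x m).mp hxle
  obtain ⟨y, hy⟩ := Ideal.mem_span_singleton'.mp hxm
  refine ⟨(PadicInt.isUnit_iff.mpr (norm_oneAddPow 0 y)).unit, ?_⟩
  rw [IsUnit.unit_spec, ← hx, ← hy, mul_comm y, show (p : ℤ_[p]) ^ m * y = (p ^ m : ℕ) • y by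
    rw [nsmul_eq_mul, Nat.cast_pow], AddChar.map_nsmul_eq_pow]

/-! ### `ℚ_pˣ = p^ℤ · ℤ_pˣ` -/

/-- **`ℚ_pˣ = p^ℤ · ℤ_pˣ`**: every non-zero `x ∈ ℚ_p` is `p^j · w` with `j ∈ ℤ`, `w ∈ ℤ_pˣ`. [folklore] -/
private theorem exists_eq_prime_zpow_mul_units (x : ℚ_[p]) (hx : x ≠ 0) :
    ∃ (j : ℤ) (w : ℤ_[p]ˣ), x = (p : ℚ_[p]) ^ j * ((w : ℤ_[p]) : ℚ_[p]) := by
  have hp0 : (p : ℚ_[p]) ≠ 0 := by exact_mod_cast hp.out.ne_zero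
  set j : ℤ := x.valuation with hj
  have hw : ‖x * (p : ℚ_[p]) ^ (-j)‖ = 1 := by
    rw [norm_mul, Padic.norm_p_zpow, neg_neg, Padic.norm_eq_zpow_neg_valuation hx, ← hj,
      ← zpow_add₀ (by exact_mod_cast hp.out.ne_zero : ((p : ℝ)) ≠ 0)]
    simp
  refine ⟨j, PadicInt.mkUnits hw, ?_⟩
  rw [PadicInt.mkUnits_eq, mul_comm, mul_assoc, ← zpow_add₀ hp0, neg_add_cancel, zpow_zero, mul_one]

/-- Uniqueness of `x = p^j · w`: the exponent and the unit are determined. [folklore] -/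
private theorem prime_zpow_mul_units_inj {j j' : ℤ} {w w' : ℤ_[p]ˣ}
    (h : (p : ℚ_[p]) ^ j * ((w : ℤ_[p]) : ℚ_[p]) = (p : ℚ_[p]) ^ j' * ((w' : ℤ_[p]) : ℚ_[p])) :
    j = j' ∧ w = w' := by
  have hp0 : (p : ℚ_[p]) ≠ 0 := by exact_mod_cast hp.out.ne_zero
  have hn := congrArg (fun z : ℚ_[p] ↦ ‖z‖) h
  simp only [norm_mul, Padic.norm_p_zpow] at hn
  rw [show ‖((w : ℤ_[p]) : ℚ_[p])‖ = 1 from PadicInt.norm_units w,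
    show ‖((w' : ℤ_[p]) : ℚ_[p])‖ = 1 from PadicInt.norm_units w', mul_one, mul_one] at hn
  have hjj : j = j' := by
    have hp1 : (1 : ℝ) < p := by exact_mod_cast hp.out.one_lt
    have := zpow_right_injective₀ (by linarith) hp1.ne' hn
    linarith
  subst hjj
  refine ⟨rfl, ?_⟩
  have hw := mul_left_cancel₀ (zpow_ne_zero j hp0) h
  exact Units.ext (Subtype.ext hw)

/-! ### The subgroup `T_m = ⟨p⟩ · {w : w^{p−1} ≡ 1 (mod p^{m+1})}` and its index -/

/-- **The subgroup `T_m` of `ℚ_pˣ` (odd `p`) and its index `≤ p^m`.** There is a subgroup of `ℚ_pˣ` whose elements are exactly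
the `p^j · w`, `j ∈ ℤ`, `w ∈ ℤ_pˣ` with `w^{p−1} ≡ 1 (mod p^{m+1})` (i.e. `w ∈ μ_{p−1}·(1 + p^{m+1}ℤ_p)`), and its index is
at most `p^m`: it is the kernel of `ℚ_pˣ → ℤ_pˣ → (ℤ/p^{m+1})ˣ → (ℤ/p^{m+1})ˣ`, `x ↦ (unit part mod p^{m+1})^{p−1}`, whose image
is killed by `p^m` (the order of `(ℤ/p^{m+1})ˣ` is `(p−1)p^m`) and hence has at most `p^m` elements (`(ℤ/p^{m+1})ˣ` is CYCLIC for
odd `p`, Mathlib `ZMod.isCyclic_units_of_prime_pow`, and `IsCyclic.card_pow_eq_one_le`). It is the norm group of the `m`-th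
layer of the cyclotomic `ℤ_p`-tower of `ℚ_p` (part 5). [cite: NeukirchANT1999, Ch. II (5.7), Ch. V (1.1)]
[cite: Serre1973, Ch. II §3.2] -/
theorem exists_subgroup_oddLayerNorm (hp2 : p ≠ 2) (m : ℕ) :
    ∃ T : Subgroup ℚ_[p]ˣ,
      (∀ x : ℚ_[p]ˣ, x ∈ T ↔ ∃ (j : ℤ) (w : ℤ_[p]ˣ),
        toZModPow (m + 1) (((w : ℤ_[p])) ^ (p - 1)) = 1 ∧
          (x : ℚ_[p]) = (p : ℚ_[p]) ^ j * ((w : ℤ_[p]) : ℚ_[p])) ∧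
      T.index ≤ p ^ m := by
  have hp0 : (p : ℚ_[p]) ≠ 0 := by exact_mod_cast hp.out.ne_zero
  -- the unit-part homomorphism `ℚ_pˣ → ℤ_pˣ`
  have hdec : ∀ x : ℚ_[p]ˣ, ∃ (j : ℤ) (w : ℤ_[p]ˣ), (x : ℚ_[p]) = (p : ℚ_[p]) ^ j * ((w : ℤ_[p]) : ℚ_[p]) :=
    fun x ↦ exists_eq_prime_zpow_mul_units (x : ℚ_[p]) x.ne_zero
  choose jv wv hjw using hdec
  let υ : ℚ_[p]ˣ →* ℤ_[p]ˣ :=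
    { toFun := wv
      map_one' := by
        have h := hjw 1
        rw [Units.val_one, show (1 : ℚ_[p]) = (p : ℚ_[p]) ^ (0 : ℤ) * (((1 : ℤ_[p]ˣ) : ℤ_[p]) : ℚ_[p])
          by simp] at h
        exact (prime_zpow_mul_units_inj h).2.symm
      map_mul' := fun x y ↦ by
        have h := hjw (x * y)
        rw [Units.val_mul, hjw x, hjw y, show (p : ℚ_[p]) ^ jv x * ((wv x : ℤ_[p]) : ℚ_[p]) *
            ((p : ℚ_[p]) ^ jv y * ((wv y : ℤ_[p]) : ℚ_[p])) =
            (p : ℚ_[p]) ^ (jv x + jv y) * (((wv x * wv y : ℤ_[p]ˣ) : ℤ_[p]) : ℚ_[p]) by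
          rw [zpow_add₀ hp0]; push_cast; ring] at h
        exact (prime_zpow_mul_units_inj h).2.symm }
  have hυ : ∀ (x : ℚ_[p]ˣ) (j : ℤ) (w : ℤ_[p]ˣ),
      (x : ℚ_[p]) = (p : ℚ_[p]) ^ j * ((w : ℤ_[p]) : ℚ_[p]) → υ x = w := by
    intro x j w h
    rw [hjw x] at h
    exact (prime_zpow_mul_units_inj h).2
  -- reduction modulo `p^{m+1}` followed by the `(p−1)`-th power
  let ρ : ℤ_[p]ˣ →* (ZMod (p ^ (m + 1)))ˣ := Units.map (toZModPow (p := p) (m + 1)).toMonoidHom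
  let π : (ZMod (p ^ (m + 1)))ˣ →* (ZMod (p ^ (m + 1)))ˣ := powMonoidHom (p - 1)
  let ψ : ℚ_[p]ˣ →* (ZMod (p ^ (m + 1)))ˣ := π.comp (ρ.comp υ)
  refine ⟨ψ.ker, fun x ↦ ?_, ?_⟩
  · -- membership
    rw [MonoidHom.mem_ker]
    change (ρ (υ x)) ^ (p - 1) = 1 ↔ _
    have hρ : ∀ w : ℤ_[p]ˣ, (((ρ w) ^ (p - 1) : (ZMod (p ^ (m + 1)))ˣ) : ZMod (p ^ (m + 1))) =
        toZModPow (m + 1) (((w : ℤ_[p])) ^ (p - 1)) := fun w ↦ by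
      rw [Units.val_pow_eq_pow_val, map_pow]; rfl
    constructor
    · intro h
      refine ⟨jv x, υ x, ?_, hjw x⟩
      rw [← hρ, h, Units.val_one]
    · rintro ⟨j, w, hw, hx⟩
      rw [hυ x j w hx]
      exact Units.ext (by rw [hρ, hw, Units.val_one])
  · -- index `≤ p^m`: the image of `ψ` is killed by `p^m`, and `#{a : a^{p^m} = 1} ≤ p^m` in the cyclic group `(ℤ/p^{m+1})ˣ`
    haveI : NeZero (p ^ (m + 1)) := ⟨pow_ne_zero _ hp.out.ne_zero⟩
    haveI hcyc : IsCyclic (ZMod (p ^ (m + 1)))ˣ := ZMod.isCyclic_units_of_prime_pow p hp.out hp2 (m + 1)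
    have hcardG : Fintype.card (ZMod (p ^ (m + 1)))ˣ = (p - 1) * p ^ m := by
      rw [ZMod.card_units_eq_totient, Nat.totient_prime_pow hp.out (by omega), Nat.add_sub_cancel, mul_comm]
    -- every element of the range is killed by `p^m`
    have hkill : ∀ c ∈ ψ.range, c ^ p ^ m = 1 := by
      rintro c ⟨x, rfl⟩
      change ((ρ (υ x)) ^ (p - 1)) ^ p ^ m = 1
      rw [← pow_mul, ← hcardG, pow_card_eq_one]
    have hsub : (ψ.range : Set (ZMod (p ^ (m + 1)))ˣ) ⊆
        ↑(Finset.univ.filter (fun a : (ZMod (p ^ (m + 1)))ˣ ↦ a ^ p ^ m = 1)) := by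
      intro c hc
      simp only [Finset.coe_filter, Finset.mem_univ, true_and, Set.mem_setOf_eq]
      exact hkill c hc
    have hle : Nat.card ψ.range ≤ p ^ m := by
      have h1 : Nat.card ψ.range ≤ Nat.card (↑(Finset.univ.filter (fun a : (ZMod (p ^ (m + 1)))ˣ ↦ a ^ p ^ m = 1)) :
          Set (ZMod (p ^ (m + 1)))ˣ) := Nat.card_mono (Set.toFinite _) hsub
      rw [Nat.card_coe_set_eq, Set.ncard_coe_finset] at h1
      exact h1.trans (IsCyclic.card_pow_eq_one_le (pow_pos hp.out.pos m))
    rw [Subgroup.index_ker]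
    exact hle

end Literature.NumberTheory.EllipticCurves.Greenberg1999.MultTowerSplitExact

end Part1

/-!
## Part 2 — port of `Summits/BirchSwinnertonDyer/BirchSwinnertonDyer/Theorems/ByReductionTypeAtTwoMultTowerSplitExactOddDepth.lean`

# Route `ByReductionTypeAtTwo`, crux `MultUpperHalfAtTwo` (item stmt-BirchSwinnertonDyer-19922), TOWER road, SPLIT rows:
# the EXACT order of the local tower kernel at a split multiplicative prime, part 8 (ODD `p`) — the `p`-ADIC DEPTH of the
# Tate unit and the Iwasawa logarithm: `ord_p(log_p q) = d`, `‖u^{p−1} − 1‖ = p^{−d}`, `u^{(p−1)p^s a} ≢ 1 (mod p^{d+s+1})`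

HONEST FRAMING (cell `bsd-2adic`, run/shared/lean/pub/bsd-2adic/, seat `bsd-2adic-tower-1` GEN 27, HUMAN RULINGS
D-0036 / D-0054 / D-0074): TOOL theorems only (no definition, no named fact, no `sorry`); closes nothing by itself;
nothing booked; BSD is not proved by any of this. Odd-`p` analogue of seat bsd-2adic-mult GEN 13's
`…MultTowerSplitOrderTwoAdicDepth.lean` (BRICK S1), for the UPPER bound of the `∀ p` named fact
`hSP = Greenberg1999.sec3_natCard_localTowerKerPrimary_splitMultiplicative_rat`:

* `padicLog_pow_eq` — `log_p (y^N) = N · log_p y`; `padicLog_prime_pow_mul` — `log_p (p^k x) = log_p x`;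
* `norm_one_sub_pow_eq` — **`‖1 − y^N‖ = ‖N‖ · ‖1 − y‖` for `‖1 − y‖ < 1`, odd `p`** (the logarithm is an ISOMETRY on
  `1 + pℤ_p` for odd `p`, the tree's `norm_padicLog_eq_norm_one_sub`, and `log y^N = N log y`);
* `toZModPow_eq_one_iff_norm_sub_one_le` — `x ≡ 1 (mod p^n) ↔ ‖x − 1‖ ≤ p^{−n}`;
* `exists_depth_of_padicLog_odd` — **the depth**: for `q = p^k u` (`u ∈ ℤ_pˣ`) with `log_p q ≠ 0` there is `d ≥ 1` with
  `‖1 − u^{p−1}‖ = p^{−d}` and `ord_p(log_p q) = d` (`log_p q = log_p u = (p−1)⁻¹ log_p u^{p−1}`);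
* `toZModPow_pow_pow_ne_one_of_depth` — **`(u^{p^s a})^{p−1} ≢ 1 (mod p^{M+1})`** for `p ∤ a` and `d + s ≤ M`
  (`‖(u^{p−1})^{p^s a} − 1‖ = p^{−(d+s)} > p^{−(M+1)}`).

References: K. Iwasawa, *Lectures on p-adic L-functions* (1972), §4.4; J.-P. Serre, *A Course in Arithmetic*, Ch. II
§3; cell memo NOTE-HNS2-KERNEL-GEN27.md (Stage D plan).
-/

section Part2

set_option autoImplicit false

open scoped _root_.Classical

namespace Literature.NumberTheory.EllipticCurves.Greenberg1999.MultTowerSplitExact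

open _root_.PadicInt Literature.NumberTheory.EllipticCurves

variable {p : ℕ} [hp : Fact p.Prime]

/-! ### The Iwasawa logarithm: powers and the isometry on `1 + pℤ_p` -/

/-- `log_p 1 = 0`. [cite: Iwasawa1972PadicL, §4.4] -/
theorem padicLog_one : padicLog p (1 : ℚ_[p]) = 0 := by
  have h := padicLog_mul_holds p (x := 1) (y := 1) one_ne_zero one_ne_zero
  rw [mul_one] at h
  linear_combination -h

/-- **`log_p (y^N) = N · log_p y`** (`y ≠ 0`). [cite: Iwasawa1972PadicL, §4.4] -/
theorem padicLog_pow_eq {y : ℚ_[p]} (hy : y ≠ 0) (N : ℕ) :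
    padicLog p (y ^ N) = (N : ℚ_[p]) * padicLog p y := by
  induction N with
  | zero => rw [pow_zero, padicLog_one, Nat.cast_zero, zero_mul]
  | succ N ih =>
    rw [pow_succ, padicLog_mul_holds p (pow_ne_zero _ hy) hy, ih]
    push_cast
    ring

/-- **`log_p (p^k · x) = log_p x`** (`x ≠ 0`): Iwasawa's normalisation `log_p p = 0`. [cite: Iwasawa1972PadicL, §4.4] -/
theorem padicLog_prime_pow_mul (k : ℕ) {x : ℚ_[p]} (hx : x ≠ 0) :
    padicLog p ((p : ℚ_[p]) ^ k * x) = padicLog p x := by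
  have hp0 : (p : ℚ_[p]) ≠ 0 := by exact_mod_cast hp.out.ne_zero
  have hlp : padicLog p (p : ℚ_[p]) = 0 := padicLog_natCast_self_holds p
  rw [padicLog_mul_holds p (pow_ne_zero _ hp0) hx, padicLog_pow_eq hp0, hlp, mul_zero, zero_add]

/-- **`‖1 − y^N‖ = ‖N‖ · ‖1 − y‖` for `‖1 − y‖ < 1` and odd `p`**: the logarithm is an isometry on the principal
units for odd `p` (`‖log_p y‖ = ‖1 − y‖`), and `log_p y^N = N log_p y`. [cite: Iwasawa1972PadicL, §4.4] -/
theorem norm_one_sub_pow_eq (hp2 : p ≠ 2) {y : ℚ_[p]} (hy : ‖1 - y‖ < 1) (N : ℕ) :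
    ‖1 - y ^ N‖ = ‖(N : ℚ_[p])‖ * ‖1 - y‖ := by
  have hy1 : ‖y‖ = 1 := norm_eq_one_of_norm_one_sub_lt hy
  have hy0 : y ≠ 0 := norm_pos_iff.mp (by rw [hy1]; exact one_pos)
  rw [← norm_padicLog_eq_norm_one_sub hp2 (norm_one_sub_pow_lt hy N), padicLog_pow_eq hy0, norm_mul,
    norm_padicLog_eq_norm_one_sub hp2 hy]

/-! ### Congruences modulo `p^n` and norms -/

/-- `x ≡ 1 (mod p^n)` in `ℤ_p` iff `‖x − 1‖ ≤ p^{−n}`. [folklore] -/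
private theorem toZModPow_eq_one_iff_norm_sub_one_le (n : ℕ) (x : ℤ_[p]) :
    toZModPow n x = 1 ↔ ‖x - 1‖ ≤ (p : ℝ) ^ (-(n : ℤ)) := by
  rw [← (toZModPow n).map_one, ← sub_eq_zero, ← map_sub, ← RingHom.mem_ker, ker_toZModPow,
    ← norm_le_pow_iff_mem_span_pow]

/-! ### The depth of the Tate unit -/

/-- **The depth from the Iwasawa logarithm (odd `p`).** For `q = p^k · u` (`u` a unit of `ℤ_p`) with `log_p q ≠ 0` there
is `d ≥ 1` with `‖1 − u^{p−1}‖ = p^{−d}` and `ord_p(log_p q) = d`: `log_p q = log_p u`, `(p − 1) log_p u = log_p u^{p−1}`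
has norm `‖1 − u^{p−1}‖` (isometry on `1 + pℤ_p`), and `‖p − 1‖ = 1`. [cite: Iwasawa1972PadicL, §4.4] -/
theorem exists_depth_of_padicLog_odd (hp2 : p ≠ 2) {q : ℚ_[p]} {k : ℕ} {u : ℤ_[p]ˣ}
    (hq : q = (p : ℚ_[p]) ^ k * ((u : ℤ_[p]) : ℚ_[p])) (hlog : padicLog p q ≠ 0) :
    ∃ d : ℕ, 1 ≤ d ∧ ‖1 - ((u : ℤ_[p]) : ℚ_[p]) ^ (p - 1)‖ = (p : ℝ) ^ (-(d : ℤ)) ∧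
      (padicLog p q).valuation = d := by
  have hu1 : ‖((u : ℤ_[p]) : ℚ_[p])‖ = 1 := PadicInt.norm_units u
  have hu0 : ((u : ℤ_[p]) : ℚ_[p]) ≠ 0 := norm_pos_iff.mp (by rw [hu1]; exact one_pos)
  have hy : ‖1 - ((u : ℤ_[p]) : ℚ_[p]) ^ (p - 1)‖ < 1 := norm_one_sub_pow_sub_one_lt hu1
  -- `‖log q‖ = ‖1 − u^{p−1}‖`
  have hlogq : padicLog p q = padicLog p ((u : ℤ_[p]) : ℚ_[p]) := by rw [hq, padicLog_prime_pow_mul k hu0]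
  have hpm1 : ‖((p - 1 : ℕ) : ℚ_[p])‖ = 1 := by
    rw [Padic.norm_natCast_eq_one_iff]
    exact ((Nat.Prime.coprime_iff_not_dvd hp.out).mpr
      (Nat.not_dvd_of_pos_of_lt (by have := hp.out.two_le; omega) (by have := hp.out.two_le; omega)))
  have hnorm : ‖padicLog p q‖ = ‖1 - ((u : ℤ_[p]) : ℚ_[p]) ^ (p - 1)‖ := by
    rw [← norm_padicLog_eq_norm_one_sub hp2 hy, padicLog_pow_eq hu0, norm_mul, hpm1, one_mul, hlogq]
  -- `1 − u^{p−1} ≠ 0`, of norm `p^{−d}`, `d ≥ 1`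
  set x : ℚ_[p] := 1 - ((u : ℤ_[p]) : ℚ_[p]) ^ (p - 1) with hx
  have hx0 : x ≠ 0 := by
    intro h0
    rw [h0, norm_zero, norm_eq_zero] at hnorm
    exact hlog hnorm
  have hxv : ‖x‖ = (p : ℝ) ^ (-x.valuation) := Padic.norm_eq_zpow_neg_valuation hx0
  have hp1 : (1 : ℝ) < p := by exact_mod_cast hp.out.one_lt
  have hd1 : 1 ≤ x.valuation := by
    have hlt : (p : ℝ) ^ (-x.valuation) < (p : ℝ) ^ (0 : ℤ) := by rw [← hxv, zpow_zero]; exact hy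
    have := (zpow_lt_zpow_iff_right₀ hp1).mp hlt
    omega
  refine ⟨x.valuation.toNat, by omega, ?_, ?_⟩
  · rw [hxv, Int.toNat_of_nonneg (by omega)]
  · rw [Int.toNat_of_nonneg (by omega)]
    exact valuation_eq_of_norm_eq hlog (by rw [hnorm, hxv])

/-- **`(u^{p^s a})^{p−1} ≢ 1 (mod p^{M+1})` for `p ∤ a` and `d + s ≤ M`**, `d` the depth of the unit `u`
(`‖1 − u^{p−1}‖ = p^{−d}`, odd `p`): `‖(u^{p−1})^{p^s a} − 1‖ = ‖p^s a‖ · p^{−d} = p^{−(d+s)} > p^{−(M+1)}`. The odd-`p` form of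
GEN 13's `toZModPow_pow_ne_one_and_ne_neg_one_of_depth`. [cite: Iwasawa1972PadicL, §4.4] [cite: Serre1973, Ch. II §3.2] -/
theorem toZModPow_pow_pow_ne_one_of_depth (hp2 : p ≠ 2) {u : ℤ_[p]ˣ} {d : ℕ}
    (hd : ‖1 - ((u : ℤ_[p]) : ℚ_[p]) ^ (p - 1)‖ = (p : ℝ) ^ (-(d : ℤ))) {a : ℕ} (ha : ¬ p ∣ a) (s : ℕ) {M : ℕ}
    (hM : d + s ≤ M) :
    toZModPow (M + 1) ((((u : ℤ_[p])) ^ (p ^ s * a)) ^ (p - 1)) ≠ 1 := by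
  intro h1
  rw [toZModPow_eq_one_iff_norm_sub_one_le] at h1
  have hp0 : (0 : ℝ) < p := by exact_mod_cast hp.out.pos
  have hp1 : (1 : ℝ) < p := by exact_mod_cast hp.out.one_lt
  -- `‖(u^{p^s a})^{p-1} − 1‖ = p^{−(d+s)}`
  have hy : ‖1 - ((u : ℤ_[p]) : ℚ_[p]) ^ (p - 1)‖ < 1 := norm_one_sub_pow_sub_one_lt (PadicInt.norm_units u)
  have hN : ‖((p ^ s * a : ℕ) : ℚ_[p])‖ = (p : ℝ) ^ (-(s : ℤ)) := by
    have ha1 : ‖(a : ℚ_[p])‖ = 1 := by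
      rw [Padic.norm_natCast_eq_one_iff]
      exact (Nat.Prime.coprime_iff_not_dvd hp.out).mpr ha
    rw [Nat.cast_mul, Nat.cast_pow, norm_mul, ha1, mul_one, Padic.norm_p_pow]
  have hnorm : ‖(((u : ℤ_[p])) ^ (p ^ s * a)) ^ (p - 1) - 1‖ = (p : ℝ) ^ (-((d : ℤ) + s)) := by
    rw [PadicInt.norm_def, PadicInt.coe_sub, PadicInt.coe_pow, PadicInt.coe_pow, PadicInt.coe_one, ← pow_mul,
      mul_comm (p ^ s * a) (p - 1), pow_mul, norm_sub_rev, norm_one_sub_pow_eq hp2 hy, hN, hd, ← zpow_add₀ hp0.ne']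
    congr 1; ring
  rw [hnorm] at h1
  have := (zpow_le_zpow_iff_right₀ hp1).mp h1
  omega

end Literature.NumberTheory.EllipticCurves.Greenberg1999.MultTowerSplitExact

end Part2

/-!
## Part 3 — port of `Summits/BirchSwinnertonDyer/BirchSwinnertonDyer/Theorems/ByReductionTypeAtTwoMultTowerSplitExactOddCyclotomic.lean`

# Route `ByReductionTypeAtTwo`, crux `MultUpperHalfAtTwo` (item stmt-BirchSwinnertonDyer-19922), TOWER road, SPLIT rows:
# the EXACT order of the local tower kernel at a split multiplicative prime, part 5 (ODD `p`) — the local layer subgroups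
# `H_m` through the cyclotomic character: `χ(σ)^{p−1} ≡ 1 (mod p^{m+1})`, and the CYCLOTOMIC ELEMENT `η_m ∈ F_m`

HONEST FRAMING (cell `bsd-2adic`, run/shared/lean/pub/bsd-2adic/, seat `bsd-2adic-tower-1` GEN 27, HUMAN RULINGS
D-0036 / D-0054 / D-0074): TOOL theorems only (no definition, no named fact, no `sorry`); closes nothing by itself;
nothing booked; BSD is not proved by any of this. Second ODD-`p` module towards the `∀ p` named fact
`hSP = Greenberg1999.sec3_natCard_localTowerKerPrimary_splitMultiplicative_rat` (its `p = 2` clause is part 3,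
`MultTowerSplitExact.sec3_natCard_localTowerKerPrimary_splitMultiplicative_two`). The odd-`p` norm group
`N(F_mˣ) = ⟨p⟩ · {w : w^{p−1} ≡ 1 (mod p^{m+1})}` (part 4 typed the right side with index `≤ p^m`) needs `p ∈ N(F_mˣ)`; the
witness is the cyclotomic element `η_m = ∏_{t^{p−1} = 1} (1 − ζ^t)` (`ζ` a `p^{m+1}`-th root of unity, `t` over the
`(p−1)`-torsion of `(ℤ/p^{m+1})ˣ`) — the norm of `1 − ζ` from `ℚ_v(ζ_{p^{m+1}})` down to the layer `F_m` — whose norm to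
`ℚ_v` is `Φ_{p^{m+1}}(1) = p`. This file (the odd-`p` analogue of GEN 9's BRICK 13a `…MultTowerNS2LocalCyclotomicAction.lean`):

* `pow_torsionOrder_eq_one_of_isOfFinOrder` — a torsion unit `ω` of `ℤ_p` has `ω^{torsionOrder p} = 1` (`torsionOrder p = p − 1`
  for odd `p`, `Kato2004.torsionOrder_of_ne_two`): the tree's normalised logarithm `CyclotomicZp.ell` (`ell ω = 0 ↔ IsOfFinOrder ω`, `γ^{t·ell u} = u^t`);
* `exists_cyclotomicCharacter_eq_of_mem_layer` — for `σ ∈ H_m`: `χ(σ) = ω · w^{p^m}` with `ω` torsion (from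
  `IsCyclotomic κ : ker κ = χ⁻¹(torsion)`, as at `p = 2`);
* `toZModPow_pow_cyclotomicCharacter_of_mem_layer` — **`χ(σ)^{p−1} ≡ 1 (mod p^{m+1})` for `σ ∈ H_m`, odd `p`**;
* `prod_one_sub_pow_mem_fixedField_layer` — **`η_m ∈ F_m`**: `σ ∈ H_m` permutes the factors `1 − ζ^t`, `t^{p−1} = 1`.

The norm computation `N_{F_m/ℚ_v}(η_m) = p` and the identification `N(F_mˣ) = T_m` are part 6.

References: L. Washington, *Introduction to Cyclotomic Fields*, §13.1, Lemma 1.4 / Prop. 2.8 (`N(1 − ζ) = p`); J.-P. Serre,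
*Local Fields* IV §4; cell memo NOTE-HNS2-KERNEL-GEN27.md (Stage D plan).
-/

section Part3

set_option autoImplicit false

open scoped _root_.Classical

namespace Literature.NumberTheory.EllipticCurves.Greenberg1999.MultTowerSplitExact

open _root_.NumberField _root_.IsDedekindDomain _root_.Field _root_.PadicInt Literature.NumberTheory.EllipticCurves
  Literature.NumberTheory.GaloisRepresentations Literature.NumberTheory.EllipticCurves.CyclotomicZp

variable {p : ℕ} [hp : Fact p.Prime] {κ : ZpExtension ℚ p}

/-! ### Torsion units of `ℤ_p` -/

/-- **A torsion unit `ω ∈ ℤ_pˣ` satisfies `ω^{torsionOrder p} = 1`** (`torsionOrder p = φ(p^{e₀}) = p − 1` for odd `p`, `2` for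
`p = 2`): `ell ω = 0` (`CyclotomicZp.ell_eq_zero_iff`) and `γ_cyc^{t · ell u} = u^t` (`CyclotomicZp.cycPow_torsionOrder_mul_ell`).
[cite: Washington1997, §5.1] [cite: Serre1973, Ch. II §3.2 Prop. 8] -/
theorem pow_torsionOrder_eq_one_of_isOfFinOrder {ω : ℤ_[p]ˣ} (hω : IsOfFinOrder ω) :
    ((ω : ℤ_[p])) ^ torsionOrder p = 1 := by
  have h0 : ell p ω = 0 := (ell_eq_zero_iff p ω).mpr hω
  have h := cycPow_torsionOrder_mul_ell p ω
  rw [h0, mul_zero, AddChar.map_zero_eq_one] at h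
  exact h.symm

/-! ### `H_m` through the cyclotomic character (odd `p`) -/

/-- **`χ(σ) = ω · w^{p^m}` for `σ ∈ H_m`, `ω` a torsion unit** (any `p`): for the cyclotomic `ℤ_p`-extension `κ`
(`ker κ = χ_p⁻¹(μ(ℤ_p))`), `v` a place and `σ` in the local layer subgroup `H_m = res_v⁻¹(κ⁻¹(p^m ℤ_p))`: writing
`κ(res σ) = p^m · κ(τ)`, the element `res σ · τ^{-p^m}` lies in `ker κ`, so its cyclotomic character is torsion; and
`χ_ℚ(res σ) = χ(σ)`. The `p`-general form of GEN 9's `exists_cyclotomicCharacter_eq_of_mem_localSubgroup_layerSubgroup`.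
[cite: Washington1997, §13.1] -/
theorem exists_cyclotomicCharacter_eq_of_mem_layer (hκ : κ.IsCyclotomic) (v : HeightOneSpectrum (𝓞 ℚ)) {m : ℕ}
    {σ : absoluteGaloisGroup (v.adicCompletion ℚ)} (hσ : σ ∈ localSubgroup (κ.layerSubgroup m) (v.adicCompletion ℚ)) :
    ∃ ω w : ℤ_[p]ˣ, IsOfFinOrder ω ∧ GaloisRep.cyclotomicCharacter (v.adicCompletion ℚ) p σ = ω * w ^ p ^ m := by
  rw [mem_localSubgroup_iff, ZpExtension.mem_layerSubgroup] at hσ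
  obtain ⟨b, hb⟩ := hσ
  set ρ := resGal (K := ℚ) (v.adicCompletion ℚ) σ with hρ
  obtain ⟨τ, hτ⟩ := κ.surjective (Multiplicative.ofAdd b)
  have hτ' : κ τ = Multiplicative.ofAdd b := hτ
  -- `ρ · (τ ^ p^m)⁻¹ ∈ ker κ`
  have hker : ρ * (τ ^ p ^ m)⁻¹ ∈ κ.kerSubgroup := by
    rw [ZpExtension.mem_kerSubgroup, map_mul, map_inv, map_pow, hτ']
    apply Multiplicative.toAdd.injective
    rw [toAdd_mul, toAdd_inv, toAdd_pow, toAdd_ofAdd, hb, toAdd_one, nsmul_eq_mul]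
    push_cast
    ring
  unfold ZpExtension.IsCyclotomic at hκ
  rw [hκ, Subgroup.mem_comap, CommGroup.mem_torsion] at hker
  have hres : GaloisRep.cyclotomicCharacter ℚ p ρ = GaloisRep.cyclotomicCharacter (v.adicCompletion ℚ) p σ :=
    cyclotomicCharacter_absGaloisRestrict ℚ (v.adicCompletion ℚ) p σ
  refine ⟨(GaloisRep.cyclotomicCharacter ℚ p).toMonoidHom (ρ * (τ ^ p ^ m)⁻¹), GaloisRep.cyclotomicCharacter ℚ p τ, hker, ?_⟩
  rw [← hres, map_mul, map_inv, map_pow]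
  change GaloisRep.cyclotomicCharacter ℚ p ρ =
    GaloisRep.cyclotomicCharacter ℚ p ρ * (GaloisRep.cyclotomicCharacter ℚ p τ ^ p ^ m)⁻¹ *
      GaloisRep.cyclotomicCharacter ℚ p τ ^ p ^ m
  rw [inv_mul_cancel_right]

/-- **`χ(σ)^{p−1} ≡ 1 (mod p^{m+1})` for `σ ∈ H_m`, odd `p`**: `χ(σ) = ω w^{p^m}` with `ω^{p−1} = 1`, and
`(w^{p−1})^{p^m} ≡ 1` since `#(ℤ/p^{m+1})ˣ = (p−1)p^m`. [cite: Washington1997, §13.1] -/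
theorem toZModPow_pow_cyclotomicCharacter_of_mem_layer (hp2 : p ≠ 2) (hκ : κ.IsCyclotomic)
    (v : HeightOneSpectrum (𝓞 ℚ)) {m : ℕ} {σ : absoluteGaloisGroup (v.adicCompletion ℚ)}
    (hσ : σ ∈ localSubgroup (κ.layerSubgroup m) (v.adicCompletion ℚ)) :
    toZModPow (m + 1) (((GaloisRep.cyclotomicCharacter (v.adicCompletion ℚ) p σ : ℤ_[p]ˣ) : ℤ_[p]) ^ (p - 1)) = 1 := by
  obtain ⟨ω, w, hω, hχ⟩ := exists_cyclotomicCharacter_eq_of_mem_layer hκ v hσ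
  -- `torsionOrder p = p - 1` for odd `p` (the tree's `Kato2004.torsionOrder_of_ne_two`, kept out of the import closure)
  have hτ : torsionOrder p = p - 1 := by
    have he : cyclotomicExponent p = 1 := by unfold cyclotomicExponent; simp [hp2]
    rw [torsionOrder, he, pow_one, Nat.totient_prime hp.out]
  have hω1 : ((ω : ℤ_[p])) ^ (p - 1) = 1 := by
    rw [← hτ]; exact pow_torsionOrder_eq_one_of_isOfFinOrder hω
  haveI : NeZero (p ^ (m + 1)) := ⟨pow_ne_zero _ hp.out.ne_zero⟩
  -- the unit `w̄ = w mod p^{m+1}` of `ℤ/p^{m+1}` has `w̄^{(p-1)p^m} = 1`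
  set wbar : (ZMod (p ^ (m + 1)))ˣ := Units.map (toZModPow (p := p) (m + 1)).toMonoidHom w with hwbar
  have hcard : Fintype.card (ZMod (p ^ (m + 1)))ˣ = (p - 1) * p ^ m := by
    rw [ZMod.card_units_eq_totient, Nat.totient_prime_pow hp.out (by omega), Nat.add_sub_cancel, mul_comm]
  have hw1 : (wbar : ZMod (p ^ (m + 1))) ^ ((p - 1) * p ^ m) = 1 := by
    rw [← hcard, ← Units.val_pow_eq_pow_val, pow_card_eq_one, Units.val_one]
  have hwval : (wbar : ZMod (p ^ (m + 1))) = toZModPow (m + 1) (w : ℤ_[p]) := rfl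
  rw [hχ, Units.val_mul, mul_pow, hω1, one_mul, Units.val_pow_eq_pow_val, ← pow_mul, map_pow, ← hwval,
    mul_comm, hw1]

/-! ### The cyclotomic element `η_m = ∏_{t^{p−1} = 1} (1 − ζ^t)` lies in `F_m` -/

/-- **`η_m ∈ F_m`** (odd `p`): for `ζ ∈ K̄_v` with `ζ^{p^{m+1}} = 1`, the product of the `1 − ζ^{t}` over the units `t` of
`ℤ/p^{m+1}` with `t^{p−1} = 1` is fixed by `H_m` — `σ ∈ H_m` acts by `ζ ↦ ζ^{χ̄(σ)}` with `χ̄(σ)^{p−1} = 1`, permuting the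
factors. [cite: Washington1997, §13.1 and Lemma 1.4] -/
theorem prod_one_sub_pow_mem_fixedField_layer (hp2 : p ≠ 2) (hκ : κ.IsCyclotomic) (v : HeightOneSpectrum (𝓞 ℚ))
    (m : ℕ) {ζ : AlgebraicClosure (v.adicCompletion ℚ)} (hζ : ζ ^ p ^ (m + 1) = 1) :
    (∏ t ∈ (Finset.univ.filter fun t : (ZMod (p ^ (m + 1)))ˣ ↦ t ^ (p - 1) = 1),
        (1 - ζ ^ ((t : ZMod (p ^ (m + 1))).val))) ∈
      IntermediateField.fixedField (localSubgroup (κ.layerSubgroup m) (v.adicCompletion ℚ)) := by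
  haveI : CharZero (v.adicCompletion ℚ) :=
    charZero_of_injective_algebraMap (algebraMap ℚ (v.adicCompletion ℚ)).injective
  haveI : NeZero ((p : ℕ) : v.adicCompletion ℚ) := ⟨by exact_mod_cast hp.out.ne_zero⟩
  haveI : NeZero (p ^ (m + 1)) := ⟨pow_ne_zero _ hp.out.ne_zero⟩
  set S : Finset (ZMod (p ^ (m + 1)))ˣ := Finset.univ.filter fun t : (ZMod (p ^ (m + 1)))ˣ ↦ t ^ (p - 1) = 1 with hS
  rw [IntermediateField.mem_fixedField_iff]
  intro σ hσ
  -- `σ ζ = ζ^{c}`, `c = χ̄(σ)`, `c^{p−1} = 1`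
  set c : (ZMod (p ^ (m + 1)))ˣ :=
    Units.map (toZModPow (p := p) (m + 1)).toMonoidHom (GaloisRep.cyclotomicCharacter (v.adicCompletion ℚ) p σ) with hc
  have hcS : c ^ (p - 1) = 1 := by
    apply Units.ext
    rw [Units.val_pow_eq_pow_val, Units.val_one]
    change toZModPow (m + 1) ((GaloisRep.cyclotomicCharacter (v.adicCompletion ℚ) p σ : ℤ_[p]ˣ) : ℤ_[p]) ^ (p - 1) = 1
    rw [← map_pow]
    exact toZModPow_pow_cyclotomicCharacter_of_mem_layer hp2 hκ v hσ
  have hσζ : σ • ζ = ζ ^ (c : ZMod (p ^ (m + 1))).val :=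
    GaloisRep.cyclotomicCharacter_spec (v.adicCompletion ℚ) p (k := m + 1) σ ζ hζ
  -- the action on a factor: `σ (1 − ζ^{t}) = 1 − ζ^{(c t)}`
  have hpowmod : ∀ a b : ZMod (p ^ (m + 1)), (ζ ^ a.val) ^ b.val = ζ ^ (b * a).val := by
    intro a b
    rw [← pow_mul, ZMod.val_mul, mul_comm a.val, pow_eq_pow_mod (b.val * a.val) hζ]
  have hfac : ∀ t : (ZMod (p ^ (m + 1)))ˣ,
      σ (1 - ζ ^ ((t : ZMod (p ^ (m + 1))).val)) = 1 - ζ ^ (((c * t : (ZMod (p ^ (m + 1)))ˣ) : ZMod (p ^ (m + 1))).val) := by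
    intro t
    rw [map_sub, map_one, map_pow]
    change 1 - (σ • ζ) ^ _ = _
    rw [hσζ, hpowmod, Units.val_mul, mul_comm]
  -- left multiplication by `c` permutes `S`
  have hperm : ∀ t ∈ S, c * t ∈ S := fun t ht ↦ by
    rw [hS, Finset.mem_filter] at ht ⊢
    exact ⟨Finset.mem_univ _, by rw [mul_pow, hcS, one_mul, ht.2]⟩
  have hgoal : σ (∏ t ∈ S, (1 - ζ ^ ((t : ZMod (p ^ (m + 1))).val))) =
      (∏ t ∈ S, (1 - ζ ^ ((t : ZMod (p ^ (m + 1))).val))) := by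
    rw [map_prod, Finset.prod_congr rfl (fun t _ ↦ hfac t)]
    refine Finset.prod_bij' (fun t _ ↦ c * t) (fun t _ ↦ c⁻¹ * t) (fun t ht ↦ hperm t ht) ?_ ?_ ?_ ?_
    · intro t ht
      rw [hS, Finset.mem_filter] at ht ⊢
      refine ⟨Finset.mem_univ _, ?_⟩
      rw [mul_pow, inv_pow, hcS, inv_one, one_mul, ht.2]
    · intro t _
      rw [inv_mul_cancel_left]
    · intro t _
      rw [mul_inv_cancel_left]
    · intro t _
      rfl
  exact hgoal

end Literature.NumberTheory.EllipticCurves.Greenberg1999.MultTowerSplitExact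

end Part3

/-!
## Part 4 — port of `Summits/BirchSwinnertonDyer/BirchSwinnertonDyer/Theorems/ByReductionTypeAtTwoMultTowerSplitExactOddCyclotomicNorm.lean`

# Route `ByReductionTypeAtTwo`, crux `MultUpperHalfAtTwo` (item stmt-BirchSwinnertonDyer-19922), TOWER road, SPLIT rows:
# the EXACT order of the local tower kernel at a split multiplicative prime, part 6 (ODD `p`) — `N_{F_m/ℚ_v}(η_m) = p`:
# the prime `p` is a norm from every local layer `F_m` of the cyclotomic `ℤ_p`-tower

HONEST FRAMING (cell `bsd-2adic`, run/shared/lean/pub/bsd-2adic/, seat `bsd-2adic-tower-1` GEN 27, HUMAN RULINGS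
D-0036 / D-0054 / D-0074): TOOL theorems only (no definition, no named fact, no `sorry`); closes nothing by itself;
nothing booked; BSD is not proved by any of this. Third ODD-`p` module towards the `∀ p` named fact
`hSP = Greenberg1999.sec3_natCard_localTowerKerPrimary_splitMultiplicative_rat`. The odd-`p` norm group
`N(F_mˣ) = ⟨p⟩ · {w : w^{p−1} ≡ 1 (mod p^{m+1})}` needs `p ∈ N(F_mˣ)`: here it is, as the norm of part 5's cyclotomic
element `η_m = ∏_{t^{p−1} = 1} (1 − ζ^t) ∈ F_m` (`ζ` a primitive `p^{m+1}`-th root of unity in `K̄_v`):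

* `prod_units_one_sub_pow_eq_prime` — `∏_{a ∈ (ℤ/p^{m+1})ˣ} (1 − ζ^a) = Φ_{p^{m+1}}(1) = p`;
* `norm_eq_prime_of_coe_eq_cyclotomicUnit` — **`N_{F_m/ℚ_v}(η_m) = p`**: with `g₀ ∈ Γ_{ℚ_v}`, `κ(res g₀) = 1`, the
  powers `g₀^j` (`j < p^m`) represent `Γ/H_m` (`GoodOrdTower.exists_pow_inv_mul_mem_localSubgroup_layerSubgroup`),
  so `N(η_m) = ∏_j g₀^j η_m = ∏_j ∏_{t ∈ S} (1 − ζ^{c^j t})` (`c = χ̄(g₀)`, `S = {t : t^{p−1} = 1}`); the map `(j, t) ↦ c^j t` hits every unit of `ℤ/p^{m+1}` (LOCAL SURJECTIVITY of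
  the cyclotomic character, the tree's `adicCompletion_rat_exists_mem_absInertia_cyclotomicCharacter_eq`: `a = χ̄(σ)`,
  `σ = g₀^j h`, `h ∈ H_m`, `χ̄(h) ∈ S` by part 5) and `#S ≤ p − 1` (cyclicity of `(ℤ/p^{m+1})ˣ`), so it is a bijection
  onto the units and the double product is `Φ_{p^{m+1}}(1) = p`;
* `exists_norm_fixedField_layer_eq_prime` — **`p ∈ N(F_mˣ)`**.

References: L. Washington, *Introduction to Cyclotomic Fields*, Lemma 1.4 / Prop. 2.8 (`N(1 − ζ) = p`) and §13.1;
J. Neukirch, *Algebraic Number Theory*, Ch. IV §1, Ch. V §1 (1.1); J.-P. Serre, *Local Fields* IV §4 Prop. 17;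
cell memo NOTE-HNS2-KERNEL-GEN27.md (Stage D plan).
-/

section Part4

set_option autoImplicit false

open scoped _root_.Classical _root_.IntermediateField

namespace Literature.NumberTheory.EllipticCurves.Greenberg1999.MultTowerSplitExact

open _root_.NumberField _root_.IsDedekindDomain _root_.Field _root_.PadicInt Literature.NumberTheory.EllipticCurves
  Literature.NumberTheory.GaloisRepresentations

variable {p : ℕ} [hp : Fact p.Prime] {κ : ZpExtension ℚ p}

/-! ### `∏_{a ∈ (ℤ/p^{m+1})ˣ} (1 − ζ^a) = p` -/

/-- **`∏_{a ∈ (ℤ/p^{m+1})ˣ} (1 − ζ^a) = Φ_{p^{m+1}}(1) = p`** for a primitive `p^{m+1}`-th root of unity `ζ` of a domain: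
the `ζ^a`, `a` a unit of `ℤ/p^{m+1}`, are exactly the primitive `p^{m+1}`-th roots of unity (Mathlib
`cyclotomic_eq_prod_X_sub_primitiveRoots`, `eval_one_cyclotomic_prime_pow`). [cite: Washington1997, Lemma 1.4] -/
theorem prod_units_one_sub_pow_eq_prime {L : Type*} [CommRing L] [IsDomain L] (m : ℕ) {ζ : L}
    (hζ : IsPrimitiveRoot ζ (p ^ (m + 1))) :
    ∏ a : (ZMod (p ^ (m + 1)))ˣ, (1 - ζ ^ ((a : ZMod (p ^ (m + 1))).val)) = (p : L) := by
  haveI : NeZero (p ^ (m + 1)) := ⟨pow_ne_zero _ hp.out.ne_zero⟩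
  have h0 : 0 < p ^ (m + 1) := pow_pos hp.out.pos _
  -- the image of `a ↦ ζ^a` on the units is the set of primitive roots
  have himage : (Finset.univ : Finset (ZMod (p ^ (m + 1)))ˣ).image
      (fun a : (ZMod (p ^ (m + 1)))ˣ ↦ ζ ^ ((a : ZMod (p ^ (m + 1))).val)) = primitiveRoots (p ^ (m + 1)) L := by
    ext μ
    rw [Finset.mem_image, mem_primitiveRoots h0]
    constructor
    · rintro ⟨a, -, rfl⟩
      exact (hζ.pow_iff_coprime h0 _).mpr (ZMod.val_coe_unit_coprime a)
    · intro hμ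
      obtain ⟨i, hi, rfl⟩ := hζ.eq_pow_of_pow_eq_one hμ.pow_eq_one
      have hcop : i.Coprime (p ^ (m + 1)) := (hζ.pow_iff_coprime h0 i).mp hμ
      refine ⟨ZMod.unitOfCoprime i hcop, Finset.mem_univ _, ?_⟩
      simp only [ZMod.coe_unitOfCoprime, ZMod.val_natCast, Nat.mod_eq_of_lt hi]
  have hinj : Set.InjOn (fun a : (ZMod (p ^ (m + 1)))ˣ ↦ ζ ^ ((a : ZMod (p ^ (m + 1))).val))
      ↑(Finset.univ : Finset (ZMod (p ^ (m + 1)))ˣ) := by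
    intro a _ b _ hab
    exact Units.ext (ZMod.val_injective _ (hζ.pow_inj (ZMod.val_lt _) (ZMod.val_lt _) hab))
  have heval := Polynomial.eval_one_cyclotomic_prime_pow (R := L) (p := p) m
  rw [Polynomial.cyclotomic_eq_prod_X_sub_primitiveRoots hζ, Polynomial.eval_prod] at heval
  simp only [Polynomial.eval_sub, Polynomial.eval_X, Polynomial.eval_C] at heval
  rw [← himage, Finset.prod_image hinj] at heval
  exact heval

/-! ### `N_{F_m/ℚ_v}(η_m) = p` -/

/-- **`N_{F_m/ℚ_v}(η_m) = p`** (odd `p`, `v ∋ p`, `κ` the cyclotomic `ℤ_p`-extension): for `ζ ∈ K̄_v` a primitive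
`p^{m+1}`-th root of unity and `f ∈ F_m = K̄_v^{H_m}` the cyclotomic element `η_m = ∏_{t ∈ S} (1 − ζ^t)`,
`S = {t ∈ (ℤ/p^{m+1})ˣ : t^{p−1} = 1}` (part 5), the norm of `f` to `ℚ_v` is `p`. With `κ(res g₀) = 1` the `g₀^j`,
`j < p^m`, represent `Γ_{ℚ_v}/H_m`, so `N(f) = ∏_j g₀^j η_m = ∏_{(j,t)} (1 − ζ^{χ̄(g₀)^j t})`; `(j, t) ↦ χ̄(g₀)^j t` is onto
`(ℤ/p^{m+1})ˣ` (every unit is a local cyclotomic character `χ̄(σ)`, `σ = g₀^j h` with `h ∈ H_m`, `χ̄(h) ∈ S`) from a set of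
size `p^m · #S ≤ p^m (p − 1)`, hence a bijection, and the product is `∏_a (1 − ζ^a) = p`.
[cite: Washington1997, §13.1 and Lemma 1.4] [cite: SerreLocalFields1979, Ch. IV §4 Prop. 17] -/
theorem norm_eq_prime_of_coe_eq_cyclotomicUnit (hp2 : p ≠ 2) (hκ : κ.IsCyclotomic) (v : HeightOneSpectrum (𝓞 ℚ))
    (hv : ((p : ℕ) : 𝓞 ℚ) ∈ v.asIdeal) (m : ℕ) {ζ : AlgebraicClosure (v.adicCompletion ℚ)}
    (hζ : IsPrimitiveRoot ζ (p ^ (m + 1)))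
    (f : IntermediateField.fixedField (localSubgroup (κ.layerSubgroup m) (v.adicCompletion ℚ)))
    (hf : (f : AlgebraicClosure (v.adicCompletion ℚ)) =
      ∏ t ∈ (Finset.univ.filter fun t : (ZMod (p ^ (m + 1)))ˣ ↦ t ^ (p - 1) = 1),
        (1 - ζ ^ ((t : ZMod (p ^ (m + 1))).val))) :
    Algebra.norm (v.adicCompletion ℚ) f = (p : v.adicCompletion ℚ) := by
  haveI : NeZero (p ^ (m + 1)) := ⟨pow_ne_zero _ hp.out.ne_zero⟩
  have hζ1 : ζ ^ p ^ (m + 1) = 1 := hζ.pow_eq_one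
  have hpK : ((p : ℕ) : v.adicCompletion ℚ) ≠ 0 := by
    rw [← map_natCast (algebraMap ℚ (v.adicCompletion ℚ))]
    exact (map_ne_zero_iff _ (algebraMap ℚ (v.adicCompletion ℚ)).injective).mpr (by exact_mod_cast hp.out.ne_zero)
  haveI : NeZero ((p : ℕ) : v.adicCompletion ℚ) := ⟨hpK⟩
  set S : Finset (ZMod (p ^ (m + 1)))ˣ := Finset.univ.filter fun t : (ZMod (p ^ (m + 1)))ˣ ↦ t ^ (p - 1) = 1 with hS
  -- the cyclotomic character modulo `p^{m+1}`
  let χb : absoluteGaloisGroup (v.adicCompletion ℚ) →* (ZMod (p ^ (m + 1)))ˣ :=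
    (Units.map (toZModPow (p := p) (m + 1)).toMonoidHom).comp
      (GaloisRep.cyclotomicCharacter (v.adicCompletion ℚ) p).toMonoidHom
  have hχb : ∀ σ : absoluteGaloisGroup (v.adicCompletion ℚ), ((χb σ : (ZMod (p ^ (m + 1)))ˣ) : ZMod (p ^ (m + 1))) =
      toZModPow (m + 1) (((GaloisRep.cyclotomicCharacter (v.adicCompletion ℚ) p σ : ℤ_[p]ˣ)) : ℤ_[p]) := fun _ ↦ rfl
  -- (1) `χ̄(h) ∈ S` for `h ∈ H_m` (part 5)
  have hHS : ∀ h ∈ localSubgroup (κ.layerSubgroup m) (v.adicCompletion ℚ), χb h ∈ S := by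
    intro h hh
    rw [hS, Finset.mem_filter]
    refine ⟨Finset.mem_univ _, Units.ext ?_⟩
    rw [Units.val_pow_eq_pow_val, hχb, ← map_pow, Units.val_one]
    exact toZModPow_pow_cyclotomicCharacter_of_mem_layer hp2 hκ v hh
  -- (2) the action on the factors: `σ (1 − ζ^t) = 1 − ζ^{χ̄(σ) t}`
  have hpowmod : ∀ a b : ZMod (p ^ (m + 1)), (ζ ^ a.val) ^ b.val = ζ ^ (b * a).val := by
    intro a b
    rw [← pow_mul, ZMod.val_mul, mul_comm a.val, pow_eq_pow_mod (b.val * a.val) hζ1]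
  have hfac : ∀ (σ : absoluteGaloisGroup (v.adicCompletion ℚ)) (t : (ZMod (p ^ (m + 1)))ˣ),
      σ • (1 - ζ ^ ((t : ZMod (p ^ (m + 1))).val)) =
        1 - ζ ^ (((χb σ * t : (ZMod (p ^ (m + 1)))ˣ) : ZMod (p ^ (m + 1))).val) := by
    intro σ t
    have hσζ : σ • ζ = ζ ^ ((χb σ : (ZMod (p ^ (m + 1)))ˣ) : ZMod (p ^ (m + 1))).val :=
      GaloisRep.cyclotomicCharacter_spec (v.adicCompletion ℚ) p (k := m + 1) σ ζ hζ1
    rw [smul_sub, smul_one, smul_pow', hσζ, hpowmod, Units.val_mul, mul_comm]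
  have horb : ∀ σ : absoluteGaloisGroup (v.adicCompletion ℚ),
      σ • (f : AlgebraicClosure (v.adicCompletion ℚ)) =
        ∏ t ∈ S, (1 - ζ ^ (((χb σ * t : (ZMod (p ^ (m + 1)))ˣ) : ZMod (p ^ (m + 1))).val)) := by
    intro σ
    rw [hf, Finset.smul_prod']
    exact Finset.prod_congr rfl fun t _ ↦ hfac σ t
  -- (3) `g₀` with `κ(res g₀) = 1` and the cosets `g₀^j H_m`, `j < p^m`
  obtain ⟨g₀, hg₀'⟩ := MultTowerNS2.surjective_kappa_comp_resGal hκ v hv (Multiplicative.ofAdd (1 : ℤ_[p]))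
  have hg₀ : ((κ (resGal (K := ℚ) (v.adicCompletion ℚ) g₀)).toAdd : ℤ_[p]) =
      (p : ℤ_[p]) ^ 0 * ((1 : ℤ_[p]ˣ) : ℤ_[p]) := by
    have h := congrArg Multiplicative.toAdd hg₀'
    rw [toAdd_ofAdd] at h
    rw [pow_zero, Units.val_one, one_mul]
    exact h
  have hdec : ∀ σ : absoluteGaloisGroup (v.adicCompletion ℚ), ∃ j : ℕ, j < p ^ m ∧
      (g₀ ^ j)⁻¹ * σ ∈ localSubgroup (κ.layerSubgroup m) (v.adicCompletion ℚ) := by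
    intro σ
    have hσ0 : σ ∈ localSubgroup (κ.layerSubgroup 0) (v.adicCompletion ℚ) := by
      rw [mem_localSubgroup_iff, ZpExtension.mem_layerSubgroup, pow_zero]; exact one_dvd _
    obtain ⟨j, hj, hjσ⟩ := GoodOrdTower.exists_pow_inv_mul_mem_localSubgroup_layerSubgroup (κ := κ) v 0 m hg₀ hσ0
    rw [Nat.zero_add] at hjσ
    exact ⟨j, hj, hjσ⟩
  have hcov : ∀ σ : absoluteGaloisGroup (v.adicCompletion ℚ), ∃ j : Fin (p ^ m),
      σ⁻¹ * g₀ ^ (j : ℕ) ∈ localSubgroup (κ.layerSubgroup m) (v.adicCompletion ℚ) := by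
    intro σ
    obtain ⟨j, hj, hjσ⟩ := hdec σ
    refine ⟨⟨j, hj⟩, ?_⟩
    have h := Subgroup.inv_mem _ hjσ
    rwa [mul_inv_rev, inv_inv] at h
  -- (4) `(j, t) ↦ χ̄(g₀)^j t` maps `[0, p^m) × S` ONTO the units of `ℤ/p^{m+1}`
  have hv' : (Rat.HeightOneSpectrum.primesEquiv v : ℕ) = p := by
    have h1 : Rat.HeightOneSpectrum.natGenerator v ∣ p := by
      rw [Rat.HeightOneSpectrum.natGenerator_dvd_iff, Ideal.mem_map_of_equiv]
      exact ⟨p, hv, map_natCast _ p⟩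
    exact (Nat.prime_dvd_prime_iff_eq (Rat.HeightOneSpectrum.prime_natGenerator v) hp.out).mp h1
  obtain ⟨Φ, hΦ⟩ : ∃ Φ : ℕ × (ZMod (p ^ (m + 1)))ˣ → (ZMod (p ^ (m + 1)))ˣ, ∀ x, Φ x = χb g₀ ^ x.1 * x.2 :=
    ⟨fun x ↦ χb g₀ ^ x.1 * x.2, fun _ ↦ rfl⟩
  have hsurj : ∀ a : (ZMod (p ^ (m + 1)))ˣ, ∃ x ∈ Finset.range (p ^ m) ×ˢ S, Φ x = a := by
    intro a
    -- a `p`-adic unit lifting `a`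
    obtain ⟨u, hu⟩ : ∃ u : ℤ_[p]ˣ, toZModPow (m + 1) (u : ℤ_[p]) = a := by
      set n : ℕ := (a : ZMod (p ^ (m + 1))).val with hn
      have hcop : n.Coprime p :=
        (ZMod.val_coe_unit_coprime a).coprime_dvd_right (dvd_pow_self p (Nat.succ_ne_zero m))
      have hpn : ¬ p ∣ n := (Nat.Prime.coprime_iff_not_dvd hp.out).mp hcop.symm
      have hun : IsUnit ((n : ℤ) : ℤ_[p]) := by
        rw [PadicInt.isUnit_iff]
        refine le_antisymm (PadicInt.norm_le_one _) ?_
        by_contra hlt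
        rw [not_le, PadicInt.norm_int_lt_one_iff_dvd] at hlt
        exact hpn (by exact_mod_cast hlt)
      refine ⟨hun.unit, ?_⟩
      rw [IsUnit.unit_spec, map_intCast, Int.cast_natCast, hn, ZMod.natCast_zmod_val]
    obtain ⟨σ, -, hσ⟩ := adicCompletion_rat_exists_mem_absInertia_cyclotomicCharacter_eq (p := p) (v := v) hv' u
    have hχσ : χb σ = a := Units.ext (by rw [hχb, hσ, hu])
    obtain ⟨j, hj, hjσ⟩ := hdec σ
    refine ⟨(j, χb ((g₀ ^ j)⁻¹ * σ)), Finset.mem_product.mpr ⟨Finset.mem_range.mpr hj, hHS _ hjσ⟩, ?_⟩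
    rw [hΦ, ← map_pow, ← map_mul, mul_inv_cancel_left, hχσ]
  haveI hcyc : IsCyclic (ZMod (p ^ (m + 1)))ˣ := ZMod.isCyclic_units_of_prime_pow p hp.out hp2 (m + 1)
  have hScard : S.card ≤ p - 1 := by
    rw [hS]
    exact IsCyclic.card_pow_eq_one_le (by have := hp.out.two_le; omega)
  have hGcard : Fintype.card (ZMod (p ^ (m + 1)))ˣ = (p - 1) * p ^ m := by
    rw [ZMod.card_units_eq_totient, Nat.totient_prime_pow hp.out (by omega), Nat.add_sub_cancel, mul_comm]
  have himage : (Finset.range (p ^ m) ×ˢ S).image Φ = Finset.univ :=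
    Finset.eq_univ_of_forall fun a ↦ Finset.mem_image.mpr (hsurj a)
  have hcardD : ((Finset.range (p ^ m) ×ˢ S).image Φ).card = (Finset.range (p ^ m) ×ˢ S).card := by
    refine le_antisymm Finset.card_image_le ?_
    rw [himage, Finset.card_univ, hGcard, Finset.card_product, Finset.card_range, mul_comm]
    exact Nat.mul_le_mul_right _ hScard
  have hinj : Set.InjOn Φ ↑(Finset.range (p ^ m) ×ˢ S) := Finset.card_image_iff.mp hcardD
  -- (5) the orbit product over the representatives is `∏_a (1 − ζ^a) = p`
  have hprod : (∏ j : Fin (p ^ m), (g₀ ^ (j : ℕ)) • (f : AlgebraicClosure (v.adicCompletion ℚ))) =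
      ∏ a : (ZMod (p ^ (m + 1)))ˣ, (1 - ζ ^ ((a : ZMod (p ^ (m + 1))).val)) := by
    rw [Fin.prod_univ_eq_prod_range (fun j ↦ (g₀ ^ j) • (f : AlgebraicClosure (v.adicCompletion ℚ))) (p ^ m)]
    have h1 : ∀ j ∈ Finset.range (p ^ m), (g₀ ^ j) • (f : AlgebraicClosure (v.adicCompletion ℚ)) =
        ∏ t ∈ S, (1 - ζ ^ ((Φ (j, t) : ZMod (p ^ (m + 1))).val)) := by
      intro j _
      rw [horb (g₀ ^ j), map_pow]
      refine Finset.prod_congr rfl fun t _ ↦ ?_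
      rw [hΦ]
    rw [Finset.prod_congr rfl h1,
      ← Finset.prod_product (Finset.range (p ^ m)) S
        (fun x ↦ (1 - ζ ^ ((Φ x : ZMod (p ^ (m + 1))).val))),
      ← Finset.prod_image (f := fun a : (ZMod (p ^ (m + 1)))ˣ ↦ (1 - ζ ^ ((a : ZMod (p ^ (m + 1))).val))) hinj,
      himage]
  -- (6) the norm as the orbit product (BRICK `algebraMap_norm_eq_prod_smul`)
  haveI := MultTowerNS2.finiteDimensional_fixedField_localSubgroup_layerSubgroup (κ := κ) v m
  have hopen := MultTowerNS2.isOpen_localSubgroup (κ.layerSubgroup m) (κ.isOpen_layerSubgroup m) (v.adicCompletion ℚ)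
  haveI := isGalois_fixedField_of_isOpen_of_normal v (localSubgroup (κ.layerSubgroup m) (v.adicCompletion ℚ)) hopen
    (by rw [localSubgroup_eq_comap]; exact Subgroup.Normal.comap inferInstance _)
  have hrank := MultTowerNS2.finrank_fixedField_localSubgroup_layerSubgroup hκ v hv m
  have hcard : Fintype.card (Fin (p ^ m)) = Module.finrank (v.adicCompletion ℚ)
      (IntermediateField.fixedField (localSubgroup (κ.layerSubgroup m) (v.adicCompletion ℚ))) := by
    rw [hrank, Fintype.card_fin]
  -- (`CharZero ℚ_v` only now: it changes the preferred `Algebra ℚ ℚ_v` instance, see BRICK 14)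
  haveI : CharZero (v.adicCompletion ℚ) :=
    charZero_of_injective_algebraMap (algebraMap ℚ (v.adicCompletion ℚ)).injective
  have hfix := fixingSubgroup_fixedField_of_isOpen _ hopen
  have hH := fun σ ↦ SetLike.ext_iff.mp hfix σ
  have hnorm := MultTowerNS2.algebraMap_norm_eq_prod_smul v _ hH (fun j : Fin (p ^ m) ↦ g₀ ^ (j : ℕ)) hcov hcard f
  rw [hprod, prod_units_one_sub_pow_eq_prime m hζ, ← map_natCast (algebraMap (v.adicCompletion ℚ)
    (AlgebraicClosure (v.adicCompletion ℚ)))] at hnorm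
  exact (algebraMap (v.adicCompletion ℚ) (AlgebraicClosure (v.adicCompletion ℚ))).injective hnorm

/-- **`p ∈ N(F_mˣ)`** (odd `p`, `v ∋ p`): some element of the `m`-th local layer `F_m` of the cyclotomic `ℤ_p`-tower has
norm `p` to `ℚ_v` — the cyclotomic element `η_m` of part 5. [cite: Washington1997, §13.1 and Lemma 1.4] -/
theorem exists_norm_fixedField_layer_eq_prime (hp2 : p ≠ 2) (hκ : κ.IsCyclotomic) (v : HeightOneSpectrum (𝓞 ℚ))
    (hv : ((p : ℕ) : 𝓞 ℚ) ∈ v.asIdeal) (m : ℕ) :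
    ∃ f : IntermediateField.fixedField (localSubgroup (κ.layerSubgroup m) (v.adicCompletion ℚ)),
      Algebra.norm (v.adicCompletion ℚ) f = (p : v.adicCompletion ℚ) := by
  have hpK : ((p : ℕ) : v.adicCompletion ℚ) ≠ 0 := by
    rw [← map_natCast (algebraMap ℚ (v.adicCompletion ℚ))]
    exact (map_ne_zero_iff _ (algebraMap ℚ (v.adicCompletion ℚ)).injective).mpr (by exact_mod_cast hp.out.ne_zero)
  haveI : NeZero ((p ^ (m + 1) : ℕ) : AlgebraicClosure (v.adicCompletion ℚ)) := ⟨by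
    rw [Nat.cast_pow, ← map_natCast (algebraMap (v.adicCompletion ℚ) (AlgebraicClosure (v.adicCompletion ℚ)))]
    exact pow_ne_zero _ ((map_ne_zero_iff _ (algebraMap _ _).injective).mpr hpK)⟩
  obtain ⟨ζ, hζ⟩ := HasEnoughRootsOfUnity.exists_primitiveRoot (AlgebraicClosure (v.adicCompletion ℚ)) (p ^ (m + 1))
  exact ⟨⟨_, prod_one_sub_pow_mem_fixedField_layer hp2 hκ v m hζ.pow_eq_one⟩,
    norm_eq_prime_of_coe_eq_cyclotomicUnit hp2 hκ v hv m hζ _ rfl⟩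

end Literature.NumberTheory.EllipticCurves.Greenberg1999.MultTowerSplitExact

end Part4

/-!
## Part 5 — port of `Summits/BirchSwinnertonDyer/BirchSwinnertonDyer/Theorems/ByReductionTypeAtTwoMultTowerSplitExactOddNormGroup.lean`

# Route `ByReductionTypeAtTwo`, crux `MultUpperHalfAtTwo` (item stmt-BirchSwinnertonDyer-19922), TOWER road, SPLIT rows:
# the EXACT order of the local tower kernel at a split multiplicative prime, part 7 (ODD `p`) — the NORM GROUP of the
# local layer `F_m`: `N(F_mˣ) = ⟨p⟩ · {w : w^{p−1} ≡ 1 (mod p^{m+1})}`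

HONEST FRAMING (cell `bsd-2adic`, run/shared/lean/pub/bsd-2adic/, seat `bsd-2adic-tower-1` GEN 27, HUMAN RULINGS
D-0036 / D-0054 / D-0074): TOOL theorems only (no definition, no named fact, no `sorry`); closes nothing by itself;
nothing booked; BSD is not proved by any of this. Fourth ODD-`p` module towards the `∀ p` named fact
`hSP = Greenberg1999.sec3_natCard_localTowerKerPrimary_splitMultiplicative_rat` — the odd-`p` analogue of GEN 9's
BRICK 14 `MultTowerNS2.mem_range_norm_fixedField_layer_iff` (`p = 2`: `N(F_mˣ) = ⟨2⟩ · ±(1 + 2^{m+2}ℤ₂)`):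

* `exists_subgroup_oddLayerNorm_pos` — part 4's subgroup `T_m = ⟨p⟩ · {w : w^{p−1} ≡ 1 (mod p^{m+1})}` of `ℚ_pˣ` with its
  index `≤ p^m` AND FINITE (`0 <` index — the kernel of a homomorphism to the finite group `(ℤ/p^{m+1})ˣ`; part 4 recorded
  only the upper bound, which does not exclude index `0`);
* `mem_range_norm_fixedField_layer_iff_odd` — **`N(F_mˣ) = e⁻¹(T_m)`** for a ring isomorphism `e : ℚ_v ≃ ℚ_p`: the norm group
  CONTAINS `p = N(η_m)` (part 6), every `p^m`-th power, and every unit `w` with `w^{p−1} ≡ 1 (mod p^{m+1})`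
  (`w^{p−1} ∈ (ℤ_pˣ)^{p^m} ⊆ N` by part 4's Hensel lemma and `w^{p^m} ∈ N`, with `gcd(p − 1, p^m) = 1`), hence `e⁻¹(T_m)`;
  both have index `p^m` (class field axiom `index_range_norm_fixedField_layer`; `p^m ∣ [ℚ_vˣ : e⁻¹ T_m] ≤ p^m`), so they
  are equal (`MultTowerNS2.subgroup_eq_of_le_of_index_eq`).

References: J. Neukirch, *Algebraic Number Theory*, Ch. II (5.7), Ch. V §1 (1.1); L. Washington, *Introduction to
Cyclotomic Fields*, §13.1; cell memo NOTE-HNS2-KERNEL-GEN27.md (Stage D plan).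
-/

section Part5

set_option autoImplicit false

open scoped _root_.Classical _root_.IntermediateField

namespace Literature.NumberTheory.EllipticCurves.Greenberg1999.MultTowerSplitExact

open _root_.NumberField _root_.IsDedekindDomain _root_.Field _root_.PadicInt Literature.NumberTheory.EllipticCurves
  Literature.NumberTheory.GaloisRepresentations

variable {p : ℕ} [hp : Fact p.Prime] {κ : ZpExtension ℚ p}

/-! ### `T_m` has finite index -/

/-- **The subgroup `T_m = ⟨p⟩ · {w : w^{p−1} ≡ 1 (mod p^{m+1})}` of `ℚ_pˣ` (odd `p`), with `0 < [ℚ_pˣ : T_m] ≤ p^m`.** As in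
part 4 (`exists_subgroup_oddLayerNorm`, whose statement records only `≤ p^m`): `T_m` is the kernel of
`x ↦ (unit part of x mod p^{m+1})^{p−1}` into the finite cyclic group `(ℤ/p^{m+1})ˣ`, whose image is killed by `p^m`.
[cite: NeukirchANT1999, Ch. II (5.7)] [cite: Serre1973, Ch. II §3.2] -/
theorem exists_subgroup_oddLayerNorm_pos (hp2 : p ≠ 2) (m : ℕ) :
    ∃ T : Subgroup ℚ_[p]ˣ,
      (∀ x : ℚ_[p]ˣ, x ∈ T ↔ ∃ (j : ℤ) (w : ℤ_[p]ˣ),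
        toZModPow (m + 1) (((w : ℤ_[p])) ^ (p - 1)) = 1 ∧
          (x : ℚ_[p]) = (p : ℚ_[p]) ^ j * ((w : ℤ_[p]) : ℚ_[p])) ∧
      T.index ≤ p ^ m ∧ 0 < T.index := by
  have hp0 : (p : ℚ_[p]) ≠ 0 := by exact_mod_cast hp.out.ne_zero
  -- the unit-part homomorphism `ℚ_pˣ → ℤ_pˣ`
  have hdec : ∀ x : ℚ_[p]ˣ, ∃ (j : ℤ) (w : ℤ_[p]ˣ), (x : ℚ_[p]) = (p : ℚ_[p]) ^ j * ((w : ℤ_[p]) : ℚ_[p]) :=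
    fun x ↦ exists_eq_prime_zpow_mul_units (x : ℚ_[p]) x.ne_zero
  choose jv wv hjw using hdec
  let υ : ℚ_[p]ˣ →* ℤ_[p]ˣ :=
    { toFun := wv
      map_one' := by
        have h := hjw 1
        rw [Units.val_one, show (1 : ℚ_[p]) = (p : ℚ_[p]) ^ (0 : ℤ) * (((1 : ℤ_[p]ˣ) : ℤ_[p]) : ℚ_[p])
          by simp] at h
        exact (prime_zpow_mul_units_inj h).2.symm
      map_mul' := fun x y ↦ by
        have h := hjw (x * y)
        rw [Units.val_mul, hjw x, hjw y, show (p : ℚ_[p]) ^ jv x * ((wv x : ℤ_[p]) : ℚ_[p]) *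
            ((p : ℚ_[p]) ^ jv y * ((wv y : ℤ_[p]) : ℚ_[p])) =
            (p : ℚ_[p]) ^ (jv x + jv y) * (((wv x * wv y : ℤ_[p]ˣ) : ℤ_[p]) : ℚ_[p]) by
          rw [zpow_add₀ hp0]; push_cast; ring] at h
        exact (prime_zpow_mul_units_inj h).2.symm }
  have hυ : ∀ (x : ℚ_[p]ˣ) (j : ℤ) (w : ℤ_[p]ˣ),
      (x : ℚ_[p]) = (p : ℚ_[p]) ^ j * ((w : ℤ_[p]) : ℚ_[p]) → υ x = w := by
    intro x j w h
    rw [hjw x] at h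
    exact (prime_zpow_mul_units_inj h).2
  -- reduction modulo `p^{m+1}` followed by the `(p−1)`-th power
  let ρ : ℤ_[p]ˣ →* (ZMod (p ^ (m + 1)))ˣ := Units.map (toZModPow (p := p) (m + 1)).toMonoidHom
  let π : (ZMod (p ^ (m + 1)))ˣ →* (ZMod (p ^ (m + 1)))ˣ := powMonoidHom (p - 1)
  let ψ : ℚ_[p]ˣ →* (ZMod (p ^ (m + 1)))ˣ := π.comp (ρ.comp υ)
  refine ⟨ψ.ker, fun x ↦ ?_, ?_, ?_⟩
  · -- membership
    rw [MonoidHom.mem_ker]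
    change (ρ (υ x)) ^ (p - 1) = 1 ↔ _
    have hρ : ∀ w : ℤ_[p]ˣ, (((ρ w) ^ (p - 1) : (ZMod (p ^ (m + 1)))ˣ) : ZMod (p ^ (m + 1))) =
        toZModPow (m + 1) (((w : ℤ_[p])) ^ (p - 1)) := fun w ↦ by
      rw [Units.val_pow_eq_pow_val, map_pow]; rfl
    constructor
    · intro h
      refine ⟨jv x, υ x, ?_, hjw x⟩
      rw [← hρ, h, Units.val_one]
    · rintro ⟨j, w, hw, hx⟩
      rw [hυ x j w hx]
      exact Units.ext (by rw [hρ, hw, Units.val_one])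
  · -- index `≤ p^m`
    haveI : NeZero (p ^ (m + 1)) := ⟨pow_ne_zero _ hp.out.ne_zero⟩
    haveI hcyc : IsCyclic (ZMod (p ^ (m + 1)))ˣ := ZMod.isCyclic_units_of_prime_pow p hp.out hp2 (m + 1)
    have hcardG : Fintype.card (ZMod (p ^ (m + 1)))ˣ = (p - 1) * p ^ m := by
      rw [ZMod.card_units_eq_totient, Nat.totient_prime_pow hp.out (by omega), Nat.add_sub_cancel, mul_comm]
    have hkill : ∀ c ∈ ψ.range, c ^ p ^ m = 1 := by
      rintro c ⟨x, rfl⟩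
      change ((ρ (υ x)) ^ (p - 1)) ^ p ^ m = 1
      rw [← pow_mul, ← hcardG, pow_card_eq_one]
    have hsub : (ψ.range : Set (ZMod (p ^ (m + 1)))ˣ) ⊆
        ↑(Finset.univ.filter (fun a : (ZMod (p ^ (m + 1)))ˣ ↦ a ^ p ^ m = 1)) := by
      intro c hc
      simp only [Finset.coe_filter, Finset.mem_univ, true_and, Set.mem_setOf_eq]
      exact hkill c hc
    have hle : Nat.card ψ.range ≤ p ^ m := by
      have h1 : Nat.card ψ.range ≤ Nat.card (↑(Finset.univ.filter (fun a : (ZMod (p ^ (m + 1)))ˣ ↦ a ^ p ^ m = 1)) :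
          Set (ZMod (p ^ (m + 1)))ˣ) := Nat.card_mono (Set.toFinite _) hsub
      rw [Nat.card_coe_set_eq, Set.ncard_coe_finset] at h1
      exact h1.trans (IsCyclic.card_pow_eq_one_le (pow_pos hp.out.pos m))
    rw [Subgroup.index_ker]
    exact hle
  · -- finite index: the range is a (nonempty) subgroup of a finite group
    rw [Subgroup.index_ker]
    exact Nat.card_pos

/-! ### The norm group of `F_m` (odd `p`) -/

/-- **`N(F_mˣ) = ⟨p⟩ · {w : w^{p−1} ≡ 1 (mod p^{m+1})}`** (odd `p`), read through a ring isomorphism `e : ℚ_v ≃ ℚ_p`: a unit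
`x` of `ℚ_v` is a norm from the `m`-th local layer `F_m` of the cyclotomic `ℤ_p`-tower iff `e x = p^j · w` with `w ∈ ℤ_pˣ`,
`w^{p−1} ≡ 1 (mod p^{m+1})`. The norm group CONTAINS `p = N(η_m)` (part 6), every `p^m`-th power, and every such unit `w`
(`w^{p−1} = c^{p^m}` by part 4, `w^{p^m}` is a norm, `gcd(p−1, p^m) = 1`), hence `e⁻¹(T_m)`; both have index `p^m`
(class field axiom; `p^m ∣ [ℚ_vˣ : e⁻¹ T_m] ≤ p^m`), so they are equal. [cite: NeukirchANT1999, Ch. V §1 Thm. (1.1)]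
[cite: Washington1997, §13.1] -/
theorem mem_range_norm_fixedField_layer_iff_odd (hp2 : p ≠ 2) (hκ : κ.IsCyclotomic) (v : HeightOneSpectrum (𝓞 ℚ))
    (hv : ((p : ℕ) : 𝓞 ℚ) ∈ v.asIdeal) (m : ℕ) (e : v.adicCompletion ℚ ≃+* ℚ_[p]) (x : (v.adicCompletion ℚ)ˣ) :
    x ∈ (Units.map (Algebra.norm (v.adicCompletion ℚ) :
        IntermediateField.fixedField (localSubgroup (κ.layerSubgroup m) (v.adicCompletion ℚ)) →*
          v.adicCompletion ℚ)).range ↔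
      ∃ (j : ℤ) (w : ℤ_[p]ˣ), toZModPow (m + 1) (((w : ℤ_[p])) ^ (p - 1)) = 1 ∧
        e (x : v.adicCompletion ℚ) = (p : ℚ_[p]) ^ j * ((w : ℤ_[p]) : ℚ_[p]) := by
  set F := IntermediateField.fixedField (localSubgroup (κ.layerSubgroup m) (v.adicCompletion ℚ)) with hF
  set S := (Units.map (Algebra.norm (v.adicCompletion ℚ) : F →* v.adicCompletion ℚ)).range with hS
  haveI := MultTowerNS2.finiteDimensional_fixedField_localSubgroup_layerSubgroup (κ := κ) v m
  have hrank : Module.finrank (v.adicCompletion ℚ) F = p ^ m :=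
    MultTowerNS2.finrank_fixedField_localSubgroup_layerSubgroup hκ v hv m
  have hp0 : ((p : ℕ) : v.adicCompletion ℚ) ≠ 0 := by
    rw [← map_natCast (algebraMap ℚ (v.adicCompletion ℚ))]
    exact (map_ne_zero_iff _ (algebraMap ℚ (v.adicCompletion ℚ)).injective).mpr (by exact_mod_cast hp.out.ne_zero)
  -- the subgroup `T = e⁻¹ (T_m)` of `ℚ_vˣ`
  obtain ⟨Tp, hTp, hTpidx, hTppos⟩ := exists_subgroup_oddLayerNorm_pos hp2 m
  let eu : (v.adicCompletion ℚ)ˣ →* ℚ_[p]ˣ := Units.map (e : v.adicCompletion ℚ →* ℚ_[p])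
  have heu : Function.Surjective eu := fun u ↦
    ⟨Units.map (e.symm : ℚ_[p] →* v.adicCompletion ℚ) u, Units.ext (by simp [eu])⟩
  set T := Tp.comap eu with hT
  have hTidx : T.index = Tp.index := by rw [hT, Subgroup.index_comap_of_surjective _ heu]
  have hmemT : ∀ y : (v.adicCompletion ℚ)ˣ, y ∈ T ↔ ∃ (j : ℤ) (w : ℤ_[p]ˣ),
      toZModPow (m + 1) (((w : ℤ_[p])) ^ (p - 1)) = 1 ∧
        e (y : v.adicCompletion ℚ) = (p : ℚ_[p]) ^ j * ((w : ℤ_[p]) : ℚ_[p]) := by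
    intro y
    rw [hT, Subgroup.mem_comap, hTp]
    rfl
  -- elements of `S`
  have hmemS : ∀ z : (v.adicCompletion ℚ)ˣ, z ∈ S ↔
      ∃ f : F, Algebra.norm (v.adicCompletion ℚ) f = (z : v.adicCompletion ℚ) := by
    intro z
    rw [hS, MonoidHom.mem_range]
    constructor
    · rintro ⟨f, hf⟩
      exact ⟨(f : F), by simp [← hf]⟩
    · rintro ⟨f, hf⟩
      have hf0 : f ≠ 0 := by
        rintro rfl
        rw [Algebra.norm_zero] at hf
        exact z.ne_zero hf.symm
      exact ⟨Units.mk0 f hf0, Units.ext (by simp [hf])⟩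
  -- `p ∈ S` (part 6) and `p^m`-th powers
  obtain ⟨f₀, hf₀⟩ := exists_norm_fixedField_layer_eq_prime hp2 hκ v hv m
  have hpS : Units.mk0 ((p : ℕ) : v.adicCompletion ℚ) hp0 ∈ S := (hmemS _).mpr ⟨f₀, by rw [hf₀, Units.val_mk0]⟩
  have hpow : ∀ z : (v.adicCompletion ℚ)ˣ, z ^ p ^ m ∈ S := fun z ↦
    (hmemS _).mpr ⟨algebraMap (v.adicCompletion ℚ) F z, by
      rw [Algebra.norm_algebraMap, hrank, Units.val_pow_eq_pow_val]⟩
  -- units `w` with `w^{p−1} ≡ 1 (mod p^{m+1})`: `e⁻¹ w ∈ S`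
  have hcop : IsCoprime ((p - 1 : ℕ) : ℤ) ((p ^ m : ℕ) : ℤ) := by
    rw [Nat.isCoprime_iff_coprime]
    have h1 : Nat.Coprime (p - 1) p :=
      ((Nat.Prime.coprime_iff_not_dvd hp.out).mpr
        (Nat.not_dvd_of_pos_of_lt (by have := hp.out.two_le; omega) (by have := hp.out.two_le; omega))).symm
    exact h1.pow_right m
  obtain ⟨a, c, hac⟩ := hcop
  have hunit : ∀ w : ℤ_[p]ˣ, toZModPow (m + 1) (((w : ℤ_[p])) ^ (p - 1)) = 1 →
      ∀ b : (v.adicCompletion ℚ)ˣ, e (b : v.adicCompletion ℚ) = ((w : ℤ_[p]) : ℚ_[p]) → b ∈ S := by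
    intro w hw b hb
    obtain ⟨c₀, hc₀⟩ := exists_units_pow_prime_pow_eq_of_toZModPow_eq_one hp2 m hw
    have hc1 : ‖((c₀ : ℤ_[p]) : ℚ_[p])‖ = 1 := PadicInt.norm_units c₀
    have hcne : e.symm ((c₀ : ℤ_[p]) : ℚ_[p]) ≠ 0 := by
      rw [ne_eq, map_eq_zero_iff _ e.symm.injective]
      exact norm_pos_iff.mp (by rw [hc1]; norm_num)
    let b' : (v.adicCompletion ℚ)ˣ := Units.mk0 (e.symm ((c₀ : ℤ_[p]) : ℚ_[p])) hcne
    have h1 : b ^ (p - 1) = b' ^ p ^ m := by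
      apply Units.ext
      apply e.injective
      rw [Units.val_pow_eq_pow_val, Units.val_pow_eq_pow_val, map_pow, map_pow, hb]
      change ((w : ℤ_[p]) : ℚ_[p]) ^ (p - 1) = (e (e.symm ((c₀ : ℤ_[p]) : ℚ_[p]))) ^ p ^ m
      rw [RingEquiv.apply_symm_apply, ← PadicInt.coe_pow, ← PadicInt.coe_pow, hc₀]
    have hS1 : b ^ (p - 1) ∈ S := by rw [h1]; exact hpow b'
    have hS2 : b ^ p ^ m ∈ S := hpow b
    have key : (b ^ (p - 1)) ^ a * (b ^ p ^ m) ^ c = b := by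
      rw [← zpow_natCast b (p - 1), ← zpow_natCast b (p ^ m), ← zpow_mul, ← zpow_mul, ← zpow_add,
        mul_comm, mul_comm _ c, hac, zpow_one]
    rw [← key]
    exact S.mul_mem (S.zpow_mem hS1 a) (S.zpow_mem hS2 c)
  -- `T ≤ S`
  have hTS : T ≤ S := by
    intro z hz
    obtain ⟨j, w, hw, hz⟩ := (hmemT z).mp hz
    have hw1 : ‖((w : ℤ_[p]) : ℚ_[p])‖ = 1 := PadicInt.norm_units w
    have hwne : e.symm ((w : ℤ_[p]) : ℚ_[p]) ≠ 0 := by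
      rw [ne_eq, map_eq_zero_iff _ e.symm.injective]
      exact norm_pos_iff.mp (by rw [hw1]; norm_num)
    let b : (v.adicCompletion ℚ)ˣ := Units.mk0 (e.symm ((w : ℤ_[p]) : ℚ_[p])) hwne
    have hb : e (b : v.adicCompletion ℚ) = ((w : ℤ_[p]) : ℚ_[p]) := by
      change e (e.symm ((w : ℤ_[p]) : ℚ_[p])) = _
      rw [RingEquiv.apply_symm_apply]
    have hzprod : z = (Units.mk0 ((p : ℕ) : v.adicCompletion ℚ) hp0) ^ j * b := by
      apply Units.ext
      apply e.injective
      rw [hz, Units.val_mul, map_mul, Units.val_zpow_eq_zpow_val, map_zpow₀, Units.val_mk0, map_natCast, hb]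
    rw [hzprod]
    exact S.mul_mem (S.zpow_mem hpS j) (hunit w hw b hb)
  -- equal indices `p^m`
  have hSidx : S.index = p ^ m := index_range_norm_fixedField_layer hκ v hv m
  have hTidx' : T.index = p ^ m := by
    have hdvd : S.index ∣ T.index := Subgroup.index_dvd_of_le hTS
    rw [hSidx] at hdvd
    rw [hTidx] at hdvd ⊢
    exact le_antisymm hTpidx (Nat.le_of_dvd hTppos hdvd)
  have hTS' : T = S :=
    MultTowerNS2.subgroup_eq_of_le_of_index_eq hTS (hTidx'.trans hSidx.symm) (by rw [hSidx]; exact pow_ne_zero _ hp.out.ne_zero)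
  rw [← hTS', hmemT]

end Literature.NumberTheory.EllipticCurves.Greenberg1999.MultTowerSplitExact

end Part5

/-!
## Part 6 — port of `Summits/BirchSwinnertonDyer/BirchSwinnertonDyer/Theorems/ByReductionTypeAtTwoMultTowerSplitExactOddNonNorm.lean`

# Route `ByReductionTypeAtTwo`, crux `MultUpperHalfAtTwo` (item stmt-BirchSwinnertonDyer-19922), TOWER road, SPLIT rows:
# the EXACT order of the local tower kernel at a split multiplicative prime, part 9 (ODD `p`) — the NON-NORM lemmas:
# `q^{p^j a} ∉ N(F_mˣ)` for `p ∤ a`, `d + j ≤ m`, and the relative form `∏_{i<p^R} g^i f ≠ q^{p^j a}`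

HONEST FRAMING (cell `bsd-2adic`, run/shared/lean/pub/bsd-2adic/, seat `bsd-2adic-tower-1` GEN 27, HUMAN RULINGS
D-0036 / D-0054 / D-0074): TOOL theorems only (no definition, no named fact, no `sorry`); closes nothing by itself;
nothing booked; BSD is not proved by any of this. Odd-`p` analogue of seat bsd-2adic-mult GEN 13's
`…MultTowerSplitOrderNonNorm.lean` (BRICK S2), for the UPPER bound of the `∀ p` named fact
`hSP = Greenberg1999.sec3_natCard_localTowerKerPrimary_splitMultiplicative_rat`:

* `prod_smul_prime_pow_add` — `N_{R+t}(x) = N_R(x)^{p^t}` when `g^{p^R} x = x` (orbit products several layers up);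
* `norm_ne_pow_of_depth_odd` — **no element of `F_m` has norm `q^{p^j a}`** (`e q = p^k u`, `u` of depth `d`:
  `‖1 − u^{p−1}‖ = p^{−d}`, `p ∤ a`, `d + j ≤ m`): norms from `F_m` have unit part `w` with `w^{p−1} ≡ 1 (mod p^{m+1})` (part 7),
  while `(u^{p^j a})^{p−1} ≢ 1 (mod p^{m+1})` (part 8);
* `prod_smul_ne_pow_of_depth_odd` — **`∏_{i<p^R} g^i f ≠ q^{p^j a}` for `f ∈ F_{n+R}`, `d + j ≤ R`**: the `g₀^i g^{i'}`
  (`i < p^n`, `i' < p^R`) represent `Γ/H_{n+R}`, so `N_{F_{n+R}/ℚ_v}(f) = ∏_i g₀^i (∏_{i'} g^{i'} f)` would be `q^{p^{n+j} a}`,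
  contradicting the absolute lemma at level `n + R ≥ d + (n + j)`.

References: J. Neukirch, *Algebraic Number Theory*, Ch. V §1 (1.1); R. Greenberg, LNM 1716 §3 (PDF pp. 92–93);
cell memo NOTE-HNS2-KERNEL-GEN27.md (Stage D plan).
-/

section Part6

set_option autoImplicit false

open scoped _root_.Classical _root_.IntermediateField

namespace Literature.NumberTheory.EllipticCurves.Greenberg1999.MultTowerSplitExact

open _root_.NumberField _root_.IsDedekindDomain _root_.Field _root_.PadicInt Literature.NumberTheory.EllipticCurves
  Literature.NumberTheory.GaloisRepresentations

/-! ### Orbit products several layers up (any `p`) -/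

section OrbitProducts

variable {K : Type*} [Field K]

/-- **`N_{R+t}(x) = N_R(x)^{p^t}` when `g^{p^R} x = x`** (`N_S(x) = ∏_{i<p^S} g^i x`): the range `[0, p^{R+t})` splits into
`p^t` blocks of length `p^R` (`MultTowerSP1.prod_smul_range_mul_eq_pow`). The `p`-general form of GEN 13's
`prod_smul_two_pow_add`. [folklore] -/
private theorem prod_smul_prime_pow_add (p : ℕ) (g : absoluteGaloisGroup K) (R : ℕ) {x : AlgebraicClosure K}
    (hx : (g ^ p ^ R) • x = x) (t : ℕ) :
    (∏ i ∈ Finset.range (p ^ (R + t)), (g ^ i) • x) = (∏ i ∈ Finset.range (p ^ R), (g ^ i) • x) ^ p ^ t := by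
  rw [pow_add, MultTowerSP1.prod_smul_range_mul_eq_pow g (p ^ R) hx (p ^ t)]

end OrbitProducts

variable {p : ℕ} [hp : Fact p.Prime] {κ : ZpExtension ℚ p}

/-! ### The absolute non-norm lemma at depth `d` (odd `p`) -/

/-- **The tower non-norm lemma at depth `d`, absolute form (odd `p`).** For `v ∋ p`, a ring isomorphism `e : ℚ_v ≃ ℚ_p`,
`q ∈ ℚ_v` with `e q = p^k · u`, `u ∈ ℤ_pˣ` of depth `d` (`‖1 − u^{p−1}‖ = p^{−d}`, i.e. `ord_p log_p q = d`, part 8), `p ∤ a`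
and `d + j ≤ m`: **no element of the local layer `F_m` has norm `q^{p^j a}`** — norms from `F_m` have unit part `w` with
`w^{p−1} ≡ 1 (mod p^{m+1})` (part 7 `mem_range_norm_fixedField_layer_iff_odd`), while `(u^{p^j a})^{p−1} ≢ 1 (mod p^{m+1})`
(part 8 `toZModPow_pow_pow_ne_one_of_depth`). [cite: NeukirchANT1999, Ch. V §1 Thm. (1.1)]
[cite: GreenbergLNM1716, §3, between Prop. 3.6 and Prop. 3.7 (PDF pp. 92–93)] -/
theorem norm_ne_pow_of_depth_odd (hp2 : p ≠ 2) (hκ : κ.IsCyclotomic) (v : HeightOneSpectrum (𝓞 ℚ))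
    (hv : ((p : ℕ) : 𝓞 ℚ) ∈ v.asIdeal) (e : v.adicCompletion ℚ ≃+* ℚ_[p]) {q : v.adicCompletion ℚ} {k : ℕ}
    {u : ℤ_[p]ˣ} (hq : e q = (p : ℚ_[p]) ^ k * ((u : ℤ_[p]) : ℚ_[p])) {d : ℕ}
    (hd : ‖1 - ((u : ℤ_[p]) : ℚ_[p]) ^ (p - 1)‖ = (p : ℝ) ^ (-(d : ℤ))) {a : ℕ} (ha : ¬ p ∣ a) {j m : ℕ}
    (hm : d + j ≤ m)
    (f : IntermediateField.fixedField (localSubgroup (κ.layerSubgroup m) (v.adicCompletion ℚ))) :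
    Algebra.norm (v.adicCompletion ℚ) f ≠ q ^ (p ^ j * a) := by
  intro hf
  have hp0 : (p : ℚ_[p]) ≠ 0 := by exact_mod_cast hp.out.ne_zero
  have hq0 : q ≠ 0 := by
    intro h0
    rw [h0, map_zero, eq_comm, mul_eq_zero] at hq
    rcases hq with h | h
    · exact absurd h (pow_ne_zero _ hp0)
    · exact u.ne_zero (PadicInt.coe_eq_zero.mp h)
  haveI := MultTowerNS2.finiteDimensional_fixedField_localSubgroup_layerSubgroup (κ := κ) v m
  have hmem : Units.mk0 (q ^ (p ^ j * a)) (pow_ne_zero _ hq0) ∈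
      (Units.map (Algebra.norm (v.adicCompletion ℚ) :
        IntermediateField.fixedField (localSubgroup (κ.layerSubgroup m) (v.adicCompletion ℚ)) →*
          v.adicCompletion ℚ)).range := by
    have hf0 : f ≠ 0 := by
      rintro rfl
      rw [Algebra.norm_zero] at hf
      exact pow_ne_zero _ hq0 hf.symm
    exact ⟨Units.mk0 f hf0, Units.ext (by simp [hf])⟩
  rw [mem_range_norm_fixedField_layer_iff_odd hp2 hκ v hv m e] at hmem
  obtain ⟨j', w', hw', hjw⟩ := hmem
  have hlhs : e (q ^ (p ^ j * a)) = (p : ℚ_[p]) ^ (((k * (p ^ j * a) : ℕ)) : ℤ) *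
      (((u ^ (p ^ j * a) : ℤ_[p]ˣ) : ℤ_[p]) : ℚ_[p]) := by
    rw [map_pow, hq, mul_pow, ← pow_mul, zpow_natCast, Units.val_pow_eq_pow_val, PadicInt.coe_pow]
  rw [Units.val_mk0, hlhs] at hjw
  obtain ⟨-, hwU⟩ := prime_zpow_mul_units_inj hjw
  -- `w' = u ^ (p^j a)` has `(w')^{p-1} ≢ 1 (mod p^{m+1})`
  rw [← hwU, Units.val_pow_eq_pow_val] at hw'
  exact toZModPow_pow_pow_ne_one_of_depth hp2 hd ha j hm hw'

/-! ### The relative non-norm lemma in orbit-product form (odd `p`) -/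

/-- **`∏_{i<p^R} g^i(f) ≠ q^{p^j a}` for `f ∈ F_{n+R}`, `d + j ≤ R`, `p ∤ a`, `q` of depth `d` (odd `p`).** Here `κ` is the
cyclotomic `ℤ_p`-extension, `v ∋ p`, `g ∈ Γ_{ℚ_v}` with `κ(res g) = p^n u_g` (a topological generator of `H_n` modulo `H_∞`),
`e : ℚ_v ≃ ℚ_p` a ring isomorphism and `q ∈ ℚ_v` with `e q = p^k u`, `‖1 − u^{p−1}‖ = p^{−d}`. With `g₀`, `κ(res g₀) = 1`,
the elements `g₀^i g^{i'}` (`i < p^n`, `i' < p^R`) represent `Γ/H_{n+R}`, so `N_{F_{n+R}/ℚ_v}(f) = ∏_i g₀^i(∏_{i'} g^{i'} f)`;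
if the inner product were `q^{p^j a} ∈ ℚ_v` the norm would be `q^{p^{n+j} a}`, contradicting `norm_ne_pow_of_depth_odd` at
level `n + R ≥ d + (n + j)`. The odd-`p` form of GEN 13's `prod_smul_ne_pow_of_depth`.
[cite: NeukirchANT1999, Ch. V §1 Thm. (1.1)] [cite: GreenbergLNM1716, §3, between Prop. 3.6 and Prop. 3.7 (PDF pp. 92–93)] -/
theorem prod_smul_ne_pow_of_depth_odd (hp2 : p ≠ 2) (hκ : κ.IsCyclotomic) (v : HeightOneSpectrum (𝓞 ℚ))
    (hv : ((p : ℕ) : 𝓞 ℚ) ∈ v.asIdeal) (e : v.adicCompletion ℚ ≃+* ℚ_[p]) {q : v.adicCompletion ℚ} {k : ℕ}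
    {u : ℤ_[p]ˣ} (hq : e q = (p : ℚ_[p]) ^ k * ((u : ℤ_[p]) : ℚ_[p])) {d : ℕ}
    (hd : ‖1 - ((u : ℤ_[p]) : ℚ_[p]) ^ (p - 1)‖ = (p : ℝ) ^ (-(d : ℤ)))
    (n : ℕ) {g : absoluteGaloisGroup (v.adicCompletion ℚ)} {ug : ℤ_[p]ˣ}
    (hug : ((κ (resGal (K := ℚ) (v.adicCompletion ℚ) g)).toAdd : ℤ_[p]) = (p : ℤ_[p]) ^ n * (ug : ℤ_[p]))
    {a : ℕ} (ha : ¬ p ∣ a) {j R : ℕ} (hR : d + j ≤ R) {f : AlgebraicClosure (v.adicCompletion ℚ)}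
    (hf : ∀ h ∈ localSubgroup (κ.layerSubgroup (n + R)) (v.adicCompletion ℚ), h • f = f) :
    (∏ i ∈ Finset.range (p ^ R), (g ^ i) • f) ≠
      algebraMap (v.adicCompletion ℚ) (AlgebraicClosure (v.adicCompletion ℚ)) (q ^ (p ^ j * a)) := by
  intro hprod
  -- a local element `g₀` with `κ(res g₀) = 1`, and the representatives `g₀^i g^{i'}` of `Γ/H_{n+R}`
  obtain ⟨g₀, hg₀'⟩ := MultTowerNS2.surjective_kappa_comp_resGal hκ v hv (Multiplicative.ofAdd (1 : ℤ_[p]))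
  have hg₀ : ((κ (resGal (K := ℚ) (v.adicCompletion ℚ) g₀)).toAdd : ℤ_[p]) =
      (p : ℤ_[p]) ^ 0 * ((1 : ℤ_[p]ˣ) : ℤ_[p]) := by
    have h := congrArg Multiplicative.toAdd hg₀'
    rw [toAdd_ofAdd] at h
    rw [pow_zero, Units.val_one, one_mul]
    exact h
  have hcov : ∀ σ : absoluteGaloisGroup (v.adicCompletion ℚ), ∃ ji : Fin (p ^ n) × Fin (p ^ R),
      σ⁻¹ * (g₀ ^ (ji.1 : ℕ) * g ^ (ji.2 : ℕ)) ∈ localSubgroup (κ.layerSubgroup (n + R)) (v.adicCompletion ℚ) := by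
    intro σ
    have hσ0 : σ ∈ localSubgroup (κ.layerSubgroup 0) (v.adicCompletion ℚ) := by
      rw [mem_localSubgroup_iff, ZpExtension.mem_layerSubgroup, pow_zero]
      exact one_dvd _
    obtain ⟨i, hi, hiσ⟩ := GoodOrdTower.exists_pow_inv_mul_mem_localSubgroup_layerSubgroup (κ := κ) v 0 n hg₀ hσ0
    rw [Nat.zero_add] at hiσ
    obtain ⟨i', hi', hi'σ⟩ := GoodOrdTower.exists_pow_inv_mul_mem_localSubgroup_layerSubgroup (κ := κ) v n R hug hiσ
    refine ⟨(⟨i, hi⟩, ⟨i', hi'⟩), ?_⟩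
    have h := Subgroup.inv_mem _ hi'σ
    have heq : ((g ^ i')⁻¹ * ((g₀ ^ i)⁻¹ * σ))⁻¹ = σ⁻¹ * (g₀ ^ i * g ^ i') := by group
    rw [heq] at h
    exact h
  -- the fixed field `F_{n+R}` and `f` as its element
  haveI := MultTowerNS2.finiteDimensional_fixedField_localSubgroup_layerSubgroup (κ := κ) v (n + R)
  have hopen := MultTowerNS2.isOpen_localSubgroup (κ.layerSubgroup (n + R)) (κ.isOpen_layerSubgroup (n + R))
    (v.adicCompletion ℚ)
  haveI := isGalois_fixedField_of_isOpen_of_normal v (localSubgroup (κ.layerSubgroup (n + R)) (v.adicCompletion ℚ))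
    hopen (by rw [localSubgroup_eq_comap]; exact Subgroup.Normal.comap inferInstance _)
  have hrank := MultTowerNS2.finrank_fixedField_localSubgroup_layerSubgroup hκ v hv (n + R)
  let f' : IntermediateField.fixedField (localSubgroup (κ.layerSubgroup (n + R)) (v.adicCompletion ℚ)) :=
    ⟨f, (IntermediateField.mem_fixedField_iff _ _).mpr fun h hh ↦ hf h hh⟩
  have hne := norm_ne_pow_of_depth_odd hp2 hκ v hv e hq hd ha (j := n + j) (m := n + R) (by omega) f'
  have hcard : Fintype.card (Fin (p ^ n) × Fin (p ^ R)) = Module.finrank (v.adicCompletion ℚ)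
      (IntermediateField.fixedField (localSubgroup (κ.layerSubgroup (n + R)) (v.adicCompletion ℚ))) := by
    rw [hrank, Fintype.card_prod, Fintype.card_fin, Fintype.card_fin, pow_add]
  -- (`CharZero ℚ_v` only now: it changes the preferred `Algebra ℚ ℚ_v` instance, see BRICK 14)
  haveI : CharZero (v.adicCompletion ℚ) :=
    charZero_of_injective_algebraMap (algebraMap ℚ (v.adicCompletion ℚ)).injective
  have hfix := fixingSubgroup_fixedField_of_isOpen _ hopen
  have hH := fun σ ↦ SetLike.ext_iff.mp hfix σ
  have hnorm := MultTowerNS2.algebraMap_norm_eq_prod_smul v _ hH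
    (fun ji : Fin (p ^ n) × Fin (p ^ R) ↦ g₀ ^ (ji.1 : ℕ) * g ^ (ji.2 : ℕ)) hcov hcard f'
  -- `∏_{i,i'} g₀^i g^{i'} f = ∏_i g₀^i (q^N) = q^{N p^n}`
  have hinner : ∀ i : Fin (p ^ n), (∏ i' : Fin (p ^ R), (g₀ ^ (i : ℕ) * g ^ (i' : ℕ)) •
      (f' : AlgebraicClosure (v.adicCompletion ℚ))) =
        algebraMap (v.adicCompletion ℚ) (AlgebraicClosure (v.adicCompletion ℚ)) (q ^ (p ^ j * a)) := by
    intro i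
    have h1 : (∏ i' : Fin (p ^ R), (g₀ ^ (i : ℕ) * g ^ (i' : ℕ)) • (f' : AlgebraicClosure (v.adicCompletion ℚ))) =
        g₀ ^ (i : ℕ) • ∏ i' ∈ Finset.range (p ^ R), (g ^ i') • f := by
      rw [← Fin.prod_univ_eq_prod_range (fun i' ↦ (g ^ i') • f) (p ^ R), Finset.smul_prod']
      refine Finset.prod_congr rfl fun i' _ ↦ ?_
      rw [mul_smul]
    rw [h1, hprod]
    exact AlgEquiv.commutes (absoluteGaloisGroup.toAlgEquiv _ (g₀ ^ (i : ℕ))) _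
  rw [Fintype.prod_prod_type, Finset.prod_congr rfl (fun i _ ↦ hinner i), Finset.prod_const, Finset.card_univ,
    Fintype.card_fin, ← map_pow, ← pow_mul] at hnorm
  have hNe : Algebra.norm (v.adicCompletion ℚ) f' = q ^ (p ^ j * a * p ^ n) :=
    (algebraMap (v.adicCompletion ℚ) (AlgebraicClosure (v.adicCompletion ℚ))).injective hnorm
  have hexp : p ^ j * a * p ^ n = p ^ (n + j) * a := by rw [pow_add]; ring
  rw [hexp] at hNe
  exact hne hNe

end Literature.NumberTheory.EllipticCurves.Greenberg1999.MultTowerSplitExact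

end Part6

/-!
## Part 7 — port of `Summits/BirchSwinnertonDyer/BirchSwinnertonDyer/Theorems/ByReductionTypeAtTwoMultTowerSplitExactOddCount.lean`

# Route `ByReductionTypeAtTwo`, crux `MultUpperHalfAtTwo` (item stmt-BirchSwinnertonDyer-19922), TOWER road, SPLIT rows:
# the EXACT order of the local tower kernel at a split multiplicative prime, part 10 (ODD `p`) — the COUNT
# `#(M_∞/(g−1)M_∞)[p^∞] ≤ p^w` for a Tate unit of depth `w + 1`

HONEST FRAMING (cell `bsd-2adic`, run/shared/lean/pub/bsd-2adic/, seat `bsd-2adic-tower-1` GEN 27, HUMAN RULINGS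
D-0036 / D-0054 / D-0074): TOOL theorems only (no definition, no named fact, no `sorry`); closes nothing by itself;
nothing booked; BSD is not proved by any of this. Odd-`p` port of seat bsd-2adic-mult GEN 13's
`…MultTowerSplitOrderPrelims.lean` (pigeonhole) and `…MultTowerSplitOrderCount.lean` (the count), for the UPPER bound of the
`∀ p` named fact `hSP = Greenberg1999.sec3_natCard_localTowerKerPrimary_splitMultiplicative_rat`:

* `exists_ne_modEq_of_mem_addSubgroup_prime` — pigeonhole in a subgroup `S ≤ ℤ` containing `p^R`, `R = j + w + 1`, and no
  `p^j a` (`p ∤ a`): among `N > p^w` elements of `S` two are congruent mod `p^R`;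
* `finite_primaryComponent_coinvariants_and_card_le_odd` — **`(M_∞/(g−1)M_∞)[p^∞]` is finite of order `≤ p^w`** for the
  split Tate module at `v ∋ p` with Tate unit of depth `w + 1` (`‖1 − u^{p−1}‖ = p^{−(w+1)}`), verbatim the GEN 13 argument
  with `2 ↦ p`, `a odd ↦ p ∤ a`, the untwisted cyclic Hilbert 90 of `MultTowerSP1`, and part 9's non-norm lemma.

References: R. Greenberg, LNM 1716 §3 (pp. 85–93); J. Silverman, *Advanced Topics*, Thm. V.3.1, V.5.3; J. Neukirch,
*Algebraic Number Theory*, Ch. IV (3.5), Ch. V §1 (1.1); cell memo NOTE-HNS2-KERNEL-GEN27.md (Stage D plan).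
-/

section Part7

set_option autoImplicit false

open scoped _root_.Classical

namespace Literature.NumberTheory.EllipticCurves.Greenberg1999.MultTowerSplitExact

open _root_.NumberField _root_.IsDedekindDomain _root_.Field _root_.WeierstrassCurve _root_.PadicInt _root_.Rat.HeightOneSpectrum
  Literature.NumberTheory.EllipticCurves Literature.NumberTheory.EllipticCurves.ResKernel
  Literature.NumberTheory.GaloisRepresentations
  Literature.NumberTheory.EllipticCurves.Greenberg1999.MultTowerNS2

variable {p : ℕ} [hp : Fact p.Prime]

/-! ### Pigeonhole in a subgroup of `ℤ` -/

/-- **Pigeonhole in a subgroup of `ℤ`.** If `S ≤ ℤ` contains `p^R`, `R = j + w + 1`, and contains no `p^j · a` with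
`p ∤ a`, then among `N > p^w` elements of `S` two are congruent mod `p^R` (`S = p^c ℤ` with `j < c ≤ R`). The `p`-general
form of GEN 13's `exists_ne_modEq_of_mem_addSubgroup`. [folklore] -/
private theorem exists_ne_modEq_of_mem_addSubgroup_prime (S : AddSubgroup ℤ) {R j w : ℕ} (hR : R = j + w + 1)
    (hmem : ((p : ℤ) ^ R) ∈ S) (hnot : ∀ a : ℕ, ¬ p ∣ a → ((p : ℤ) ^ j * a) ∉ S)
    {N : ℕ} (hN : p ^ w < N) (b : Fin N → ℤ) (hb : ∀ i, b i ∈ S) :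
    ∃ i i' : Fin N, i ≠ i' ∧ b i ≡ b i' [ZMOD (p : ℤ) ^ R] := by
  obtain ⟨d, hd⟩ := Int.subgroup_cyclic S
  have hmemS : ∀ x : ℤ, x ∈ S ↔ (d.natAbs : ℤ) ∣ x := by
    intro x
    rw [hd, AddSubgroup.mem_closure_singleton, Int.natAbs_dvd]
    constructor
    · rintro ⟨n, rfl⟩
      exact ⟨n, by rw [smul_eq_mul, mul_comm]⟩
    · rintro ⟨n, rfl⟩
      exact ⟨n, by rw [smul_eq_mul, mul_comm]⟩
  -- `|d| = p^c` with `j < c ≤ R`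
  have hdvd : d.natAbs ∣ p ^ R := by
    have h := (hmemS _).mp hmem
    exact_mod_cast Int.natAbs_dvd_natAbs.mpr h
  obtain ⟨c, hcR, hc⟩ := (Nat.dvd_prime_pow hp.out).mp hdvd
  have hjc : j < c := by
    by_contra hle
    push Not at hle
    apply hnot 1 hp.out.not_dvd_one
    rw [hmemS, hc, Nat.cast_one, mul_one]
    exact_mod_cast pow_dvd_pow p hle
  -- `b i = p^c * t i`
  have ht : ∀ i, ∃ t : ℤ, b i = (p : ℤ) ^ c * t := fun i ↦ by
    obtain ⟨t, ht⟩ := (hmemS _).mp (hb i)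
    exact ⟨t, by rw [ht, hc]; push_cast; ring⟩
  choose t ht using ht
  -- pigeonhole on `t i mod p^(R - c)`
  have hcard : Fintype.card (ZMod (p ^ (R - c))) < Fintype.card (Fin N) := by
    rw [ZMod.card, Fintype.card_fin]
    calc p ^ (R - c) ≤ p ^ w := Nat.pow_le_pow_right hp.out.pos (by omega)
      _ < N := hN
  obtain ⟨i, i', hii', h⟩ := Fintype.exists_ne_map_eq_of_card_lt (fun i ↦ (t i : ZMod (p ^ (R - c)))) hcard
  refine ⟨i, i', hii', ?_⟩
  have hmod : t i ≡ t i' [ZMOD ((p ^ (R - c) : ℕ) : ℤ)] := (ZMod.intCast_eq_intCast_iff _ _ _).mp h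
  have h2 := Int.ModEq.mul_left' (c := (p : ℤ) ^ c) hmod
  rw [← ht, ← ht] at h2
  have hRc : (p : ℤ) ^ c * (((p ^ (R - c) : ℕ)) : ℤ) = (p : ℤ) ^ R := by
    push_cast
    rw [← pow_add, Nat.add_sub_cancel' hcR]
  rwa [hRc] at h2

/-! ### The count: `#(M_∞/(g−1)M_∞)[p^∞] ≤ p^w` -/

variable {κ : ZpExtension ℚ p}

/-- **The `p`-power torsion of the coinvariants of the split Tate module has at most `p^w` elements (odd `p`).** Setting:
`κ` the cyclotomic `ℤ_p`-extension, `v ∋ p`, `Φ : K̄_vˣ ↠ E(K̄_v)` with kernel `q^ℤ` and `σ • Φ(u) = Φ(σu)` (BRICK S3),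
`e : ℚ_v ≃ ℚ_p` a ring isomorphism with `e q = p^k u`, `‖1 − u^{p−1}‖ = p^{−(w+1)}` (depth `w + 1`), `g ∈ H_n` generating
`H_n` topologically with `H_∞`, `M_∞ = E(K̄_v)^{H_∞}`. Then `(M_∞/(g−1)M_∞)[p^∞]` is finite of order `≤ p^w`: among any
`p^w + 1` classes two coincide (representatives at a common level `R = j + w + 1`, exponents `B` of `N_R(x) = Q^B` in the
subgroup `S ≤ ℤ` of admissible exponents — part 9's non-norm lemma excludes `p^j a`, `p ∤ a` —, pigeonhole
`exists_ne_modEq_of_mem_addSubgroup_prime`, cyclic Hilbert 90 `MultTowerSP1.exists_eq_smul_div_of_prod_smul_eq_one`).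
The odd-`p` port of seat bsd-2adic-mult GEN 13's `MultTowerSplitOrder.finite_primaryComponent_coinvariants_and_card_le`.
[cite: GreenbergLNM1716, §3 (pp. 85–93)] [cite: SilvermanATAEC1994, Thm. V.3.1 (c)(d), Thm. V.5.3]
[cite: NeukirchANT1999, Ch. IV (3.5) and Ch. V §1 Thm. (1.1)] -/
theorem finite_primaryComponent_coinvariants_and_card_le_odd (hp2 : p ≠ 2) (hκ : κ.IsCyclotomic)
    (v : HeightOneSpectrum (𝓞 ℚ)) (hv : ((p : ℕ) : 𝓞 ℚ) ∈ v.asIdeal) {W : WeierstrassCurve ℚ}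
    {Φ : Additive (AlgebraicClosure (v.adicCompletion ℚ))ˣ →+ localPoints W (v.adicCompletion ℚ)}
    {q : v.adicCompletion ℚ} (hsurj : Function.Surjective Φ)
    (hker : ∀ u : (AlgebraicClosure (v.adicCompletion ℚ))ˣ, Φ (Additive.ofMul u) = 0 ↔
      ∃ n : ℤ, (u : AlgebraicClosure (v.adicCompletion ℚ)) =
        algebraMap (v.adicCompletion ℚ) (AlgebraicClosure (v.adicCompletion ℚ)) q ^ n)
    (hequiv : ∀ (σ : absoluteGaloisGroup (v.adicCompletion ℚ)) (u u' : (AlgebraicClosure (v.adicCompletion ℚ))ˣ),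
      (u' : AlgebraicClosure (v.adicCompletion ℚ)) = σ • (u : AlgebraicClosure (v.adicCompletion ℚ)) →
        σ • Φ (Additive.ofMul u) = Φ (Additive.ofMul u'))
    (hq0 : q ≠ 0) (hq1 : ‖q‖ < 1)
    (e : v.adicCompletion ℚ ≃+* ℚ_[p]) {k : ℕ} {u : ℤ_[p]ˣ} (hq : e q = (p : ℚ_[p]) ^ k * ((u : ℤ_[p]) : ℚ_[p]))
    {w : ℕ} (hd : ‖1 - ((u : ℤ_[p]) : ℚ_[p]) ^ (p - 1)‖ = (p : ℝ) ^ (-((w : ℤ) + 1)))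
    (n : ℕ) {g : absoluteGaloisGroup (v.adicCompletion ℚ)}
    (hgn : g ∈ localSubgroup (κ.layerSubgroup n) (v.adicCompletion ℚ))
    (hgen : ∀ U : Subgroup (absoluteGaloisGroup (v.adicCompletion ℚ)),
      IsOpen (U : Set (absoluteGaloisGroup (v.adicCompletion ℚ))) →
        localSubgroup κ.kerSubgroup (v.adicCompletion ℚ) ≤ U → g ∈ U →
          localSubgroup (κ.layerSubgroup n) (v.adicCompletion ℚ) ≤ U) :
    Finite (AddCommGroup.primaryComponent
      (FixedPoints.addSubgroup (localSubgroup κ.kerSubgroup (v.adicCompletion ℚ)) (localPoints W (v.adicCompletion ℚ)) ⧸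
        (subOne (localSubgroup κ.kerSubgroup (v.adicCompletion ℚ)) (localPoints W (v.adicCompletion ℚ)) g).range) p) ∧
    Nat.card (AddCommGroup.primaryComponent
      (FixedPoints.addSubgroup (localSubgroup κ.kerSubgroup (v.adicCompletion ℚ)) (localPoints W (v.adicCompletion ℚ)) ⧸
        (subOne (localSubgroup κ.kerSubgroup (v.adicCompletion ℚ)) (localPoints W (v.adicCompletion ℚ)) g).range) p) ≤
      p ^ w := by
  -- notation and the layer subgroups
  set K := AlgebraicClosure (v.adicCompletion ℚ) with hK
  set Hi := localSubgroup κ.kerSubgroup (v.adicCompletion ℚ) with hHi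
  have hile : ∀ m : ℕ, Hi ≤ localSubgroup (κ.layerSubgroup m) (v.adicCompletion ℚ) := fun m τ hτ ↦ by
    rw [mem_localSubgroup_iff]
    rw [hHi, mem_localSubgroup_iff] at hτ
    exact κ.kerSubgroup_le_layerSubgroup m hτ
  have hanti : ∀ {m m' : ℕ}, m ≤ m' → localSubgroup (κ.layerSubgroup m') (v.adicCompletion ℚ) ≤
      localSubgroup (κ.layerSubgroup m) (v.adicCompletion ℚ) := fun h ↦ Subgroup.comap_mono (κ.layerSubgroup_antitone h)
  -- the Tate parameter in `K̄_v`
  set Q : K := algebraMap (v.adicCompletion ℚ) K q with hQ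
  have hQ0 : Q ≠ 0 := by rw [hQ]; exact (map_ne_zero _).mpr hq0
  have hQfix : ∀ σ : absoluteGaloisGroup (v.adicCompletion ℚ), σ • Q = Q := fun σ ↦
    AlgEquiv.commutes (absoluteGaloisGroup.toAlgEquiv _ σ) q
  have hQtor : ∀ j : ℤ, Q ^ j = 1 → j = 0 := by
    intro j hj
    have hj' : q ^ j = 1 := by
      apply (algebraMap (v.adicCompletion ℚ) K).injective
      rw [map_zpow₀, map_one]; exact hj
    have hpow : ∀ m : ℕ, q ^ m = 1 → m = 0 := fun m hm ↦ by
      by_contra hm0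
      have h1 : ‖q‖ ^ m < 1 := pow_lt_one₀ (norm_nonneg q) hq1 hm0
      rw [← norm_pow, hm, norm_one] at h1
      exact lt_irrefl _ h1
    cases j with
    | ofNat m =>
      rw [Int.ofNat_eq_natCast, zpow_natCast] at hj'
      rw [Int.ofNat_eq_natCast, hpow m hj']
      rfl
    | negSucc m =>
      rw [zpow_negSucc, inv_eq_one] at hj'
      exact absurd (hpow (m + 1) hj') (Nat.succ_ne_zero m)
  -- `κ(res g) = p^n · unit` (BRICK 15) and its consequences
  obtain ⟨ug, hug⟩ := MultTowerSP1.exists_units_kappa_resGal_eq_of_generate hκ v hv n hgn hgen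
  have hd' : ‖1 - ((u : ℤ_[p]) : ℚ_[p]) ^ (p - 1)‖ = (p : ℝ) ^ (-(((w + 1 : ℕ)) : ℤ)) := by
    rw [hd]; norm_cast
  have hgpow : ∀ R : ℕ, g ^ p ^ R ∈ localSubgroup (κ.layerSubgroup (n + R)) (v.adicCompletion ℚ) := fun R ↦
    (MultTowerSP1.pow_mem_localSubgroup_layerSubgroup_iff (κ := κ) v n R hug (p ^ R)).mpr dvd_rfl
  have hgiQ : ∀ i : ℕ, (g ^ i) • Q = Q := fun i ↦ hQfix _
  -- orbit products
  have hNQ : ∀ (R : ℕ) (c : ℤ), (∏ i ∈ Finset.range (p ^ R), (g ^ i) • (Q ^ c)) = Q ^ (c * (p : ℤ) ^ R) := by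
    intro R c
    rw [prod_smul_eq_pow_of_smul_eq g (p ^ R) (by rw [smul_zpow₀', hQfix]), ← zpow_natCast, ← zpow_mul,
      Nat.cast_pow]
  -- the coinvariants
  set P := localPoints W (v.adicCompletion ℚ) with hP
  set M : AddSubgroup P := FixedPoints.addSubgroup Hi P with hM
  have memM : ∀ {a : P}, a ∈ M ↔ ∀ h ∈ Hi, h • a = a := fun {a} ↦ by
    rw [hM, FixedPoints.mem_addSubgroup]
    exact ⟨fun H h hh ↦ H ⟨h, hh⟩, fun H h ↦ H h h.2⟩
  set d : M →+ M := subOne Hi P g with hd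
  set T := AddCommGroup.primaryComponent (M ⧸ d.range) p with hT
  -- (A) representatives: every class in `T` is `[Φ x]` with `x ∈ F_{n+R₀}`, `N_{R₀}(x) = Q^B`
  have hrep : ∀ y : T, ∃ (x : Kˣ) (m : M) (R₀ : ℕ) (B : ℤ),
      ((m : M ⧸ d.range) = (y : M ⧸ d.range)) ∧ (m : P) = Φ (Additive.ofMul x) ∧
      (∀ h ∈ localSubgroup (κ.layerSubgroup (n + R₀)) (v.adicCompletion ℚ), h • (x : K) = x) ∧
      (∏ i ∈ Finset.range (p ^ R₀), (g ^ i) • (x : K)) = Q ^ B := by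
    rintro ⟨y, hy⟩
    obtain ⟨a, ha⟩ := (AddCommGroup.mem_primaryComponent).mp hy
    obtain ⟨m, rfl⟩ := QuotientAddGroup.mk_surjective y
    obtain ⟨x, hxm, hxL⟩ := MultTowerSplitOrder.exists_unit_of_mem_fixedPoints_split (κ := κ) v hsurj hker hequiv hQfix
      hQ0 hQtor (memM.mp m.2)
    -- `p^a m ∈ (g-1) M_∞`
    have h2m : ((p ^ a) • m : M) ∈ d.range := by
      rw [← QuotientAddGroup.eq_zero_iff]
      exact ha
    obtain ⟨wM, hw⟩ := h2m
    obtain ⟨z, hzm, hzL⟩ := MultTowerSplitOrder.exists_unit_of_mem_fixedPoints_split (κ := κ) v hsurj hker hequiv hQfix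
      hQ0 hQtor (memM.mp wM.2)
    -- `Φ (x^{p^a}) = Φ (gz / z)`, so `x^{p^a} = Q^b · gz/z`
    set gz : Kˣ := Units.mk0 (g • (z : K)) ((smul_ne_zero_iff_ne g).mpr z.ne_zero) with hgz
    have hgΦ : g • Φ (Additive.ofMul z) = Φ (Additive.ofMul gz) := hequiv g z gz rfl
    have h3 : Φ (Additive.ofMul (x ^ p ^ a)) = Φ (Additive.ofMul (gz * z⁻¹)) := by
      rw [ofMul_pow, map_nsmul, hxm, ofMul_mul, ofMul_inv, map_add, map_neg, ← hgΦ, hzm, ← sub_eq_add_neg]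
      have h4 := congrArg (fun b : M ↦ (b : P)) hw
      simp only [hd, AddSubgroupClass.coe_nsmul] at h4
      exact h4.symm
    rw [tatePsi_eq_iff v hker] at h3
    obtain ⟨b, hb⟩ := h3
    rw [Units.val_pow_eq_pow_val, Units.val_mul, Units.val_inv_eq_inv_val, hgz, Units.val_mk0] at hb
    -- finite levels for `x` and `z`
    obtain ⟨m₁, hm₁⟩ := MultTowerSP1.exists_forall_mem_localSubgroup_layerSubgroup_smul_eq (κ := κ) v (x : K) hxL
    obtain ⟨m₂, hm₂⟩ := MultTowerSP1.exists_forall_mem_localSubgroup_layerSubgroup_smul_eq (κ := κ) v (z : K) hzL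
    set R₁ : ℕ := m₁ + m₂ with hR₁
    have hxR₁ : ∀ h ∈ localSubgroup (κ.layerSubgroup (n + R₁)) (v.adicCompletion ℚ), h • (x : K) = x :=
      fun h hh ↦ hm₁ h (hanti (by omega) hh)
    have hzR₁ : ∀ h ∈ localSubgroup (κ.layerSubgroup (n + R₁)) (v.adicCompletion ℚ), h • (z : K) = z :=
      fun h hh ↦ hm₂ h (hanti (by omega) hh)
    have hgx : (g ^ p ^ R₁) • (x : K) = x := hxR₁ _ (hgpow R₁)
    have hgzR : (g ^ p ^ R₁) • (z : K) = z := hzR₁ _ (hgpow R₁)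
    -- `N_{R₁}(x)^{p^a} = Q^{b p^{R₁}}`
    have hNz : (∏ i ∈ Finset.range (p ^ R₁), (g ^ i) • (z : K)) ≠ 0 :=
      Finset.prod_ne_zero_iff.mpr fun i _ ↦ (smul_ne_zero_iff_ne _).mpr z.ne_zero
    have hN1 : (∏ i ∈ Finset.range (p ^ R₁), (g ^ i) • (x : K)) ^ p ^ a = Q ^ (b * (p : ℤ) ^ R₁) := by
      calc (∏ i ∈ Finset.range (p ^ R₁), (g ^ i) • (x : K)) ^ p ^ a
          = ∏ i ∈ Finset.range (p ^ R₁), (g ^ i) • ((x : K) ^ p ^ a) := by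
            rw [← Finset.prod_pow]
            exact Finset.prod_congr rfl fun i _ ↦ (smul_pow' _ _ _).symm
        _ = ∏ i ∈ Finset.range (p ^ R₁), (g ^ i) • (Q ^ b * (g • (z : K) * (z : K)⁻¹)) := by rw [hb]
        _ = (∏ i ∈ Finset.range (p ^ R₁), (g ^ i) • (Q ^ b)) *
              ((∏ i ∈ Finset.range (p ^ R₁), (g ^ i) • (g • (z : K))) *
                ∏ i ∈ Finset.range (p ^ R₁), (g ^ i) • (z : K)⁻¹) := by rw [prod_smul_mul, prod_smul_mul]
        _ = Q ^ (b * (p : ℤ) ^ R₁) := by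
            rw [hNQ, prod_smul_smul_eq g (p ^ R₁) hgzR, prod_smul_inv, mul_inv_cancel₀ hNz, mul_one]
    -- one more raise by `a` levels: `N_{R₁+a}(x) = N_{R₁}(x)^{p^a}`
    refine ⟨x, m, R₁ + a, b * (p : ℤ) ^ R₁, rfl, hxm.symm, fun h hh ↦ hxR₁ h (hanti (by omega) hh), ?_⟩
    rw [prod_smul_prime_pow_add p g R₁ hgx a, hN1]
  -- (B) coincidence: equal exponents mod `p^R` at a common level give equal classes
  have hcoinc : ∀ (R : ℕ) (x₁ x₂ : Kˣ) (B₁ B₂ : ℤ),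
      (∀ h ∈ localSubgroup (κ.layerSubgroup (n + R)) (v.adicCompletion ℚ), h • (x₁ : K) = x₁) →
      (∀ h ∈ localSubgroup (κ.layerSubgroup (n + R)) (v.adicCompletion ℚ), h • (x₂ : K) = x₂) →
      (∏ i ∈ Finset.range (p ^ R), (g ^ i) • (x₁ : K)) = Q ^ B₁ →
      (∏ i ∈ Finset.range (p ^ R), (g ^ i) • (x₂ : K)) = Q ^ B₂ →
      B₁ ≡ B₂ [ZMOD (p : ℤ) ^ R] →
      ∃ mw : M, (d mw : P) = Φ (Additive.ofMul x₁) - Φ (Additive.ofMul x₂) := by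
    intro R x₁ x₂ B₁ B₂ hx₁ hx₂ hN₁ hN₂ hmod
    obtain ⟨c, hc⟩ := (Int.modEq_iff_dvd.mp hmod.symm)
    -- `uel = (x₁/x₂) · Q^{-c}` has orbit product `1`
    set uel : K := (x₁ : K) * (x₂ : K)⁻¹ * Q ^ (-c) with huel
    have hufix : ∀ h ∈ localSubgroup (κ.layerSubgroup (n + R)) (v.adicCompletion ℚ), h • uel = uel :=
      fun h hh ↦ by rw [huel, smul_mul', smul_mul', smul_inv'', hx₁ h hh, hx₂ h hh, smul_zpow₀', hQfix]
    have hN : (∏ i ∈ Finset.range (p ^ R), (g ^ i) • uel) = 1 := by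
      have h3 : ∀ i : ℕ, (g ^ i) • uel = (g ^ i) • (x₁ : K) * (g ^ i) • (x₂ : K)⁻¹ * (g ^ i) • (Q ^ (-c)) := fun i ↦ by
        rw [huel, smul_mul', smul_mul']
      rw [Finset.prod_congr rfl (fun i _ ↦ h3 i), Finset.prod_mul_distrib, Finset.prod_mul_distrib, hN₁, prod_smul_inv,
        hN₂, hNQ, ← zpow_neg, ← zpow_add₀ hQ0, ← zpow_add₀ hQ0]
      have hexp : B₁ + -B₂ + -c * (p : ℤ) ^ R = 0 := by linear_combination hc
      rw [hexp, zpow_zero]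
    obtain ⟨y, hy0, hyfix, hyu⟩ :=
      MultTowerSP1.exists_eq_smul_div_of_prod_smul_eq_one (κ := κ) v n R hug hufix hN
    -- `Φ y ∈ M_∞` and `Φ x₁ − Φ x₂ = (g − 1) Φ y`
    set yU : Kˣ := Units.mk0 y hy0 with hyU
    have hyM : Φ (Additive.ofMul yU) ∈ M :=
      memM.mpr (MultTowerSplitOrder.apply_mem_fixedPoints_split v hequiv Hi (x := yU)
        (fun h hh ↦ by rw [hyU, Units.val_mk0]; exact hyfix h (hile _ hh)))
    set gy : Kˣ := Units.mk0 (g • y) ((smul_ne_zero_iff_ne g).mpr hy0) with hgy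
    have hgΦ : g • Φ (Additive.ofMul yU) = Φ (Additive.ofMul gy) :=
      hequiv g yU gy (by rw [hgy, hyU, Units.val_mk0, Units.val_mk0])
    refine ⟨⟨Φ (Additive.ofMul yU), hyM⟩, ?_⟩
    have hdP : (d ⟨Φ (Additive.ofMul yU), hyM⟩ : P) = g • Φ (Additive.ofMul yU) - Φ (Additive.ofMul yU) := rfl
    rw [hdP, hgΦ]
    have e1 : Φ (Additive.ofMul x₁) - Φ (Additive.ofMul x₂) = Φ (Additive.ofMul (x₁ * x₂⁻¹)) := by
      rw [ofMul_mul, ofMul_inv, map_add, map_neg, sub_eq_add_neg]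
    have e2 : Φ (Additive.ofMul gy) - Φ (Additive.ofMul yU) = Φ (Additive.ofMul (gy * yU⁻¹)) := by
      rw [ofMul_mul, ofMul_inv, map_add, map_neg, sub_eq_add_neg]
    rw [e1, e2, tatePsi_eq_iff v hker]
    refine ⟨-c, ?_⟩
    rw [Units.val_mul, Units.val_inv_eq_inv_val, Units.val_mul, Units.val_inv_eq_inv_val, hgy, hyU, Units.val_mk0,
      Units.val_mk0]
    -- goal: `g • y * y⁻¹ = Q ^ (-c) * (x₁ * x₂⁻¹)`
    have hx12 : (x₁ : K) * (x₂ : K)⁻¹ = g • y / y * Q ^ c := by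
      rw [← hyu, huel, mul_assoc, ← zpow_add₀ hQ0, neg_add_cancel, zpow_zero, mul_one]
    rw [hx12, div_eq_mul_inv, mul_comm (g • y * y⁻¹) (Q ^ c), ← mul_assoc, ← zpow_add₀ hQ0, neg_add_cancel,
      zpow_zero, one_mul]
  -- (C) among `p^w + 1` classes two coincide
  have key : ∀ ys : Fin (p ^ w + 1) → T, ∃ i i' : Fin (p ^ w + 1), i ≠ i' ∧ ys i = ys i' := by
    intro ys
    choose x m R₀ B hmy hmx hxR hNx using fun i ↦ hrep (ys i)
    -- a common level `R = j + w + 1`, `j = ∑ R₀`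
    set j : ℕ := ∑ i, R₀ i with hj
    set R : ℕ := j + w + 1 with hR
    have hRi : ∀ i, R₀ i ≤ R := fun i ↦ by
      have : R₀ i ≤ j := by rw [hj]; exact Finset.single_le_sum (fun i _ ↦ Nat.zero_le _) (Finset.mem_univ i)
      omega
    have hxRR : ∀ i, ∀ h ∈ localSubgroup (κ.layerSubgroup (n + R)) (v.adicCompletion ℚ), h • (x i : K) = x i :=
      fun i h hh ↦ hxR i h (hanti (by linarith [hRi i]) hh)
    -- exponents at level `R`
    have hNR : ∀ i, ∃ B' : ℤ, (∏ i' ∈ Finset.range (p ^ R), (g ^ i') • (x i : K)) = Q ^ B' := by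
      intro i
      obtain ⟨t, ht⟩ := Nat.exists_eq_add_of_le (hRi i)
      refine ⟨B i * (p : ℤ) ^ t, ?_⟩
      rw [ht, prod_smul_prime_pow_add p g (R₀ i) (hxR i _ (hgpow (R₀ i))) t, hNx, ← zpow_natCast, ← zpow_mul,
        Nat.cast_pow]
    choose B' hB' using hNR
    -- the subgroup of admissible exponents
    let S : AddSubgroup ℤ :=
      { carrier := {c : ℤ | ∃ f : K, f ≠ 0 ∧
          (∀ h ∈ localSubgroup (κ.layerSubgroup (n + R)) (v.adicCompletion ℚ), h • f = f) ∧
          (∏ i ∈ Finset.range (p ^ R), (g ^ i) • f) = Q ^ c}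
        add_mem' := by
          rintro c₁ c₂ ⟨f₁, hf₁, hf₁R, hN₁⟩ ⟨f₂, hf₂, hf₂R, hN₂⟩
          refine ⟨f₁ * f₂, mul_ne_zero hf₁ hf₂, fun h hh ↦ by rw [smul_mul', hf₁R h hh, hf₂R h hh], ?_⟩
          rw [prod_smul_mul, hN₁, hN₂, zpow_add₀ hQ0]
        zero_mem' := ⟨1, one_ne_zero, fun h _ ↦ smul_one h, by
          rw [prod_smul_eq_pow_of_smul_eq g (p ^ R) (smul_one g), one_pow, zpow_zero]⟩
        neg_mem' := by
          rintro c ⟨f, hf, hfR, hN⟩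
          refine ⟨f⁻¹, inv_ne_zero hf, fun h hh ↦ by rw [smul_inv'', hfR h hh], ?_⟩
          rw [prod_smul_inv, hN, zpow_neg] }
    have hmemS : ((p : ℤ) ^ R) ∈ S := ⟨Q, hQ0, fun h _ ↦ hQfix h, by
      rw [prod_smul_eq_pow_of_smul_eq g (p ^ R) (hQfix g), ← zpow_natCast, Nat.cast_pow]⟩
    have hnotS : ∀ a : ℕ, ¬ p ∣ a → ((p : ℤ) ^ j * a) ∉ S := by
      rintro a ha ⟨f, hf, hfR, hN⟩
      have hne := prod_smul_ne_pow_of_depth_odd hp2 hκ v hv e hq hd' n hug ha (j := j) (R := R) (by omega) hfR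
      apply hne
      rw [hN, map_pow, ← zpow_natCast, Nat.cast_mul, Nat.cast_pow]
    have hBS : ∀ i, B' i ∈ S := fun i ↦ ⟨(x i : K), (x i).ne_zero, hxRR i, hB' i⟩
    obtain ⟨i, i', hii', hmodB⟩ :=
      exists_ne_modEq_of_mem_addSubgroup_prime S hR hmemS hnotS (Nat.lt_succ_self _) B' hBS
    refine ⟨i, i', hii', ?_⟩
    obtain ⟨mw, hmw⟩ := hcoinc R (x i) (x i') (B' i) (B' i') (hxRR i) (hxRR i') (hB' i) (hB' i') hmodB
    have hmm : (m i : M ⧸ d.range) = m i' := by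
      rw [QuotientAddGroup.eq_iff_sub_mem]
      refine ⟨mw, Subtype.ext ?_⟩
      rw [AddSubgroupClass.coe_sub, hmx, hmx]
      exact hmw
    exact Subtype.ext (by rw [← hmy i, ← hmy i', hmm])
  -- hence `T` is finite of order `≤ p^w`
  haveI hfin : Finite T := by
    by_contra hinf
    rw [not_finite_iff_infinite] at hinf
    let emb := Infinite.natEmbedding T
    obtain ⟨i, i', hii', h⟩ := key (fun i : Fin (p ^ w + 1) ↦ emb i)
    exact hii' (Fin.ext (emb.injective h))
  refine ⟨hfin, ?_⟩
  by_contra hlt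
  push Not at hlt
  letI := Fintype.ofFinite T
  rw [Nat.card_eq_fintype_card] at hlt
  let emb : Fin (p ^ w + 1) ↪ T := (Fin.castLEEmb hlt).trans (Fintype.equivFin _).symm.toEmbedding
  obtain ⟨i, i', hii', h⟩ := key emb
  exact hii' (emb.injective h)

end Literature.NumberTheory.EllipticCurves.Greenberg1999.MultTowerSplitExact

end Part7

/-!
## Part 8 — port of `Summits/BirchSwinnertonDyer/BirchSwinnertonDyer/Theorems/ByReductionTypeAtTwoMultTowerSplitExactOdd.lean`

# Route `ByReductionTypeAtTwo`, crux `MultUpperHalfAtTwo` (item stmt-BirchSwinnertonDyer-19922), TOWER road, SPLIT rows: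
# the EXACT order of the local tower kernel at a split multiplicative prime, part 11 — ODD `p` assembled and the `∀ p`
# named fact `Greenberg1999.sec3_natCard_localTowerKerPrimary_splitMultiplicative_rat` DISCHARGED

HONEST FRAMING (cell `bsd-2adic`, run/shared/lean/pub/bsd-2adic/, seat `bsd-2adic-tower-1` GEN 27, HUMAN RULINGS
D-0036 / D-0054 / D-0074): theorems only (no definition, no `sorry`); the last declaration's TYPE is the PRINT named fact
`hSP = Literature.NumberTheory.EllipticCurves.Greenberg1999.sec3_natCard_localTowerKerPrimary_splitMultiplicative_rat`
(Greenberg, LNM 1716 §3 pp. 90–93 over the tower of `ℚ`: `#ker(r_{v_n}) = p^{ord_p(log_p q_E) − ord_p(2p)}` at a split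
multiplicative `p`, every layer), so the gate records it as DISCHARGED — the ~600 consumer files keep their `(hSP : …)`
binder but the fact is now a theorem of the tree. Nothing booked under D-0054; BSD is not proved by any of this; the
consumers' other binders (`hEC`, `h414`, …) are untouched.

* `exists_eq_prime_pow_mul_units_of_norm_lt_one` — `ℚ_pˣ ∩ {‖x‖ < 1} ⊆ p^ℕ · ℤ_pˣ`;
* `finite_and_natCard_localTowerKerPrimary_le_pow_splitOdd` — **UPPER bound** `#𝒦_{v,n}[p^∞] ≤ p^w` for odd `p` with
  `ord_p(log_p q_E) = w + 1`: uniformise at `v` (BRICK S3), depth `‖1 − u^{p−1}‖ = p^{−(w+1)}` (part 8), the count (part 10)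
  and `𝒦_{v,n}[p^∞] ↪ (M_∞/(g−1)M_∞)[p^∞]` (`finite_localTowerKerPrimary_and_card_le`);
* `pow_le_natCard_localTowerKerPrimary_splitOdd` — **LOWER bound** `p^w ≤ #𝒦_{v,n}[p^∞]`: `q_E^{p^n} = p^{kp^n} u^{p^n}` with
  `(u^{p^n})^{p−1} ≡ 1 (mod p^{n+w+1})` lies in `N(F_{n+w}ˣ)` (part 7), the transfer (part 2) gives `x ∈ F_{n+w}` with
  `N_{F_{n+w}/F_n}(x) = q_E`, whose class has order exactly `p^w` (part 1);
* `finite_and_natCard_localTowerKerPrimary_eq_pow_splitOdd`, `sec3_natCard_localTowerKerPrimary_splitMultiplicative_odd` —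
  the odd-`p` clause (`ord_p(2p) = 1`);
* `sec3_natCard_localTowerKerPrimary_splitMultiplicative_rat_holds` — **the named fact, all `p`** (`p = 2`: part 3).

References: R. Greenberg, LNM 1716 §3 (PDF pp. 90–93); J. Silverman, *Advanced Topics*, Thm. V.3.1, V.5.3; J. Neukirch,
*Algebraic Number Theory*, Ch. IV (3.5), Ch. V §1 (1.1); L. Washington, *Cyclotomic Fields* §13.1; K. Iwasawa, *Lectures on
p-adic L-functions* §4.4; cell memo NOTE-HNS2-KERNEL-GEN27.md.
-/

section Part8

set_option autoImplicit false

open scoped _root_.Classical _root_.IntermediateField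

namespace Literature.NumberTheory.EllipticCurves.Greenberg1999.MultTowerSplitExact

open _root_.NumberField _root_.IsDedekindDomain _root_.Field _root_.WeierstrassCurve _root_.PadicInt _root_.Rat.HeightOneSpectrum
  Literature.NumberTheory.EllipticCurves Literature.NumberTheory.EllipticCurves.ResKernel
  Literature.NumberTheory.GaloisRepresentations
  Literature.NumberTheory.EllipticCurves.Greenberg1999.MultTowerNS2
  Literature.NumberTheory.EllipticCurves.Greenberg1999.MultTowerSplitOrder

variable {p : ℕ} [hp : Fact p.Prime]

/-- `ℚ_pˣ ∩ {‖x‖ < 1} ⊆ p^ℕ · ℤ_pˣ`: a non-zero `x ∈ ℚ_p` with `‖x‖ < 1` is `p^k · u`, `k ∈ ℕ`, `u` a unit. The `p`-general form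
of GEN 13's `exists_eq_two_pow_mul_units`. [folklore] -/
private theorem exists_eq_prime_pow_mul_units_of_norm_lt_one {x : ℚ_[p]} (hx0 : x ≠ 0) (hx : ‖x‖ < 1) :
    ∃ (k : ℕ) (u : ℤ_[p]ˣ), x = (p : ℚ_[p]) ^ k * ((u : ℤ_[p]) : ℚ_[p]) := by
  obtain ⟨j, u, hju⟩ := exists_eq_prime_zpow_mul_units x hx0
  have hp1 : (1 : ℝ) < p := by exact_mod_cast hp.out.one_lt
  have hj : 0 ≤ j := by
    by_contra hneg
    push Not at hneg
    have hn : ‖x‖ = (p : ℝ) ^ (-j) := by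
      rw [hju, norm_mul, Padic.norm_p_zpow, show ‖((u : ℤ_[p]) : ℚ_[p])‖ = 1 from PadicInt.norm_units u, mul_one]
    have : (1 : ℝ) ≤ (p : ℝ) ^ (-j) := one_le_zpow₀ hp1.le (by omega)
    linarith
  refine ⟨j.toNat, u, ?_⟩
  rw [hju, ← zpow_natCast, Int.toNat_of_nonneg hj]

variable {κ : ZpExtension ℚ p}

/-! ### The odd-`p` kernel theorems -/

/-- **UPPER bound at a split multiplicative ODD `p`: `#𝒦_{v,n}[p^∞] ≤ p^w`** for `W/ℚ` elliptic with a Tate datum `Dq` at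
`p`, `log_p q_E ≠ 0`, `ord_p(log_p q_E) = w + 1`, every cyclotomic `κ`, `v ∋ p`, every layer `n` (uniformisation BRICK S3,
depth part 8, count part 10, `𝒦_{v,n}[p^∞] ↪ (M_∞/(g−1)M_∞)[p^∞]`). The odd-`p` form of GEN 13's
`finite_and_natCard_localTowerKerPrimary_le_pow_splitTwo`. [cite: GreenbergLNM1716, §3, between Prop. 3.6 and Prop. 3.7 (PDF pp. 92–93)]
[cite: SilvermanATAEC1994, Thm. V.3.1, V.5.3] [cite: NeukirchANT1999, Ch. IV (3.5)] -/
theorem finite_and_natCard_localTowerKerPrimary_le_pow_splitOdd (hp2 : p ≠ 2) (W : WeierstrassCurve ℚ) [W.IsElliptic]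
    (Dq : TateParameterData W p) (hlog : padicLog p Dq.q ≠ 0) {w : ℕ}
    (hw : (padicLog p Dq.q).valuation = (w : ℤ) + 1) (κ : ZpExtension ℚ p) (hκ : κ.IsCyclotomic)
    (v : HeightOneSpectrum (𝓞 ℚ)) (hv : ((p : ℕ) : 𝓞 ℚ) ∈ v.asIdeal) (n : ℕ) :
    Finite (W.localTowerKerPrimary κ (v.adicCompletion ℚ) n) ∧
      Nat.card (W.localTowerKerPrimary κ (v.adicCompletion ℚ) n) ≤ p ^ w := by
  -- the uniformisation at `v` and the identification with `Dq.q`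
  have hsplitv := hasSplitMultiplicativeReductionAt_of_atPrime W v hv Dq.split
  obtain ⟨q, Φ, hq0, hq1, hqj, hsurj, hker, hequiv⟩ := exists_tateUniformisation_tateJ W v hsplitv
  obtain ⟨e, he⟩ := exists_ringEquiv_tateParameter p v hv
  have heq : e q = Dq.q := he W q hq0 hq1 hqj Dq
  -- `Dq.q = p^k' u`, `u` of depth `w + 1`
  obtain ⟨k', u, hqu⟩ := exists_eq_prime_pow_mul_units_of_norm_lt_one Dq.q_ne_zero Dq.norm_q_lt_one
  obtain ⟨d, -, hd, hval⟩ := exists_depth_of_padicLog_odd hp2 hqu hlog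
  have hdw : (d : ℤ) = (w : ℤ) + 1 := by rw [← hval, hw]
  have hd' : ‖1 - ((u : ℤ_[p]) : ℚ_[p]) ^ (p - 1)‖ = (p : ℝ) ^ (-((w : ℤ) + 1)) := by rw [hd, hdw]
  have hq : e q = (p : ℚ_[p]) ^ k' * ((u : ℤ_[p]) : ℚ_[p]) := by rw [heq, hqu]
  -- equivariance in value form
  have hequiv' : ∀ (σ : absoluteGaloisGroup (v.adicCompletion ℚ)) (w w' : (AlgebraicClosure (v.adicCompletion ℚ))ˣ),
      (w' : AlgebraicClosure (v.adicCompletion ℚ)) = σ • (w : AlgebraicClosure (v.adicCompletion ℚ)) →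
        σ • Φ (Additive.ofMul w) = Φ (Additive.ofMul w') := by
    intro σ w w' h
    have hw' : w' = Units.map (absoluteGaloisGroup.toAlgEquiv (v.adicCompletion ℚ) σ :
        AlgebraicClosure (v.adicCompletion ℚ) →* AlgebraicClosure (v.adicCompletion ℚ)) w := Units.ext h
    rw [hw']
    exact hequiv σ w
  -- a topological generator and the count
  obtain ⟨g, hgn, hgen⟩ := ZpExtension.exists_mem_localSubgroup_generate κ (v.adicCompletion ℚ) n
  obtain ⟨hfinT, hcardT⟩ := finite_primaryComponent_coinvariants_and_card_le_odd hp2 hκ v hv hsurj hker hequiv' hq0 hq1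
    e hq hd' n hgn hgen
  haveI := hfinT
  obtain ⟨hfin, hcard⟩ := finite_localTowerKerPrimary_and_card_le W κ (v.adicCompletion ℚ) n hgn hgen
  exact ⟨hfin, hcard.trans hcardT⟩

/-- **LOWER bound at a split multiplicative ODD `p`: `p^w ≤ #𝒦_{v,n}[p^∞]`** with `ord_p(log_p q_E) = w + 1` (every
cyclotomic `κ`, `v ∋ p`, every layer `n`): uniformise (BRICK S3), read `q_E = p^k u` with `‖1 − u^{p−1}‖ = p^{−(w+1)}`; then
`q_E^{p^n} = p^{kp^n} · u^{p^n}` with `(u^{p^n})^{p−1} ≡ 1 (mod p^{n+w+1})` lies in `N(F_{n+w}ˣ)` (part 7); the transfer (part 2)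
gives `x ∈ F_{n+w}` with `N_{F_{n+w}/F_n}(x) = q_E`, whose class has order exactly `p^w` (part 1). The odd-`p` form of part 3's
`pow_le_natCard_localTowerKerPrimary_splitTwo`. [cite: GreenbergLNM1716, §3, between Prop. 3.6 and Prop. 3.7 (PDF pp. 92–93)]
[cite: SilvermanATAEC1994, Thm. V.3.1, V.5.3] [cite: NeukirchANT1999, Ch. IV (3.5) and Ch. V §1 Thm. (1.1)] -/
theorem pow_le_natCard_localTowerKerPrimary_splitOdd (hp2 : p ≠ 2) (W : WeierstrassCurve ℚ) [W.IsElliptic]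
    (Dq : TateParameterData W p) (hlog : padicLog p Dq.q ≠ 0) {w : ℕ}
    (hw : (padicLog p Dq.q).valuation = (w : ℤ) + 1) (κ : ZpExtension ℚ p) (hκ : κ.IsCyclotomic)
    (v : HeightOneSpectrum (𝓞 ℚ)) (hv : ((p : ℕ) : 𝓞 ℚ) ∈ v.asIdeal) (n : ℕ) :
    p ^ w ≤ Nat.card (W.localTowerKerPrimary κ (v.adicCompletion ℚ) n) := by
  -- the uniformisation at `v` and the identification with `Dq.q`
  have hsplitv := hasSplitMultiplicativeReductionAt_of_atPrime W v hv Dq.split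
  obtain ⟨q, Φ, hq0, hq1, hqj, hsurj, hker, hequiv⟩ := exists_tateUniformisation_tateJ W v hsplitv
  obtain ⟨e, he⟩ := exists_ringEquiv_tateParameter p v hv
  have heq : e q = Dq.q := he W q hq0 hq1 hqj Dq
  obtain ⟨k', u, hqu⟩ := exists_eq_prime_pow_mul_units_of_norm_lt_one Dq.q_ne_zero Dq.norm_q_lt_one
  obtain ⟨d, -, hd, hval⟩ := exists_depth_of_padicLog_odd hp2 hqu hlog
  have hdw : (d : ℤ) = (w : ℤ) + 1 := by rw [← hval, hw]
  have hd' : ‖1 - ((u : ℤ_[p]) : ℚ_[p]) ^ (p - 1)‖ = (p : ℝ) ^ (-((w : ℤ) + 1)) := by rw [hd, hdw]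
  have hq : e q = (p : ℚ_[p]) ^ k' * ((u : ℤ_[p]) : ℚ_[p]) := by rw [heq, hqu]
  -- equivariance in value form
  have hequiv' : ∀ (σ : absoluteGaloisGroup (v.adicCompletion ℚ)) (w₁ w' : (AlgebraicClosure (v.adicCompletion ℚ))ˣ),
      (w' : AlgebraicClosure (v.adicCompletion ℚ)) = σ • (w₁ : AlgebraicClosure (v.adicCompletion ℚ)) →
        σ • Φ (Additive.ofMul w₁) = Φ (Additive.ofMul w') := by
    intro σ w₁ w' h
    have hw' : w' = Units.map (absoluteGaloisGroup.toAlgEquiv (v.adicCompletion ℚ) σ :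
        AlgebraicClosure (v.adicCompletion ℚ) →* AlgebraicClosure (v.adicCompletion ℚ)) w₁ := Units.ext h
    rw [hw']
    exact hequiv σ w₁
  -- the Tate parameter in `K̄_v`
  set Q : AlgebraicClosure (v.adicCompletion ℚ) := algebraMap (v.adicCompletion ℚ) (AlgebraicClosure (v.adicCompletion ℚ)) q
    with hQ
  have hQ0 : Q ≠ 0 := by rw [hQ]; exact (map_ne_zero _).mpr hq0
  have hQfix : ∀ σ : absoluteGaloisGroup (v.adicCompletion ℚ), σ • Q = Q := fun σ ↦
    AlgEquiv.commutes (absoluteGaloisGroup.toAlgEquiv _ σ) q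
  have hQtor : ∀ j : ℤ, Q ^ j = 1 → j = 0 := by
    intro j hj
    have hj' : q ^ j = 1 := by
      apply (algebraMap (v.adicCompletion ℚ) (AlgebraicClosure (v.adicCompletion ℚ))).injective
      rw [map_zpow₀, map_one]; exact hj
    have hpow : ∀ m : ℕ, q ^ m = 1 → m = 0 := fun m hm ↦ by
      by_contra hm0
      have h1 : ‖q‖ ^ m < 1 := pow_lt_one₀ (norm_nonneg q) hq1 hm0
      rw [← norm_pow, hm, norm_one] at h1
      exact lt_irrefl _ h1
    cases j with
    | ofNat m =>
      rw [Int.ofNat_eq_natCast, zpow_natCast] at hj'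
      rw [Int.ofNat_eq_natCast, hpow m hj']
      rfl
    | negSucc m =>
      rw [zpow_negSucc, inv_eq_one] at hj'
      exact absurd (hpow (m + 1) hj') (Nat.succ_ne_zero m)
  -- a topological generator
  obtain ⟨g, hgn, hgen⟩ := ZpExtension.exists_mem_localSubgroup_generate κ (v.adicCompletion ℚ) n
  obtain ⟨ug, hug⟩ := MultTowerSP1.exists_units_kappa_resGal_eq_of_generate hκ v hv n hgn hgen
  -- finiteness of the `p`-primary coinvariants (part 10)
  obtain ⟨hfinT, -⟩ := finite_primaryComponent_coinvariants_and_card_le_odd hp2 hκ v hv hsurj hker hequiv' hq0 hq1 e hq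
    hd' n hgn hgen
  haveI := hfinT
  -- `q^{p^n} ∈ N(F_{n+w}ˣ)` (part 7): unit part `u^{p^n}` with `(u^{p^n})^{p-1} ≡ 1 (mod p^{n+w+1})`
  have hp0' : (0 : ℝ) < p := by exact_mod_cast hp.out.pos
  have hu1 : ‖((u : ℤ_[p]) : ℚ_[p])‖ = 1 := PadicInt.norm_units u
  have hy : ‖1 - ((u : ℤ_[p]) : ℚ_[p]) ^ (p - 1)‖ < 1 := norm_one_sub_pow_sub_one_lt hu1
  have hcong : toZModPow (n + w + 1) ((((u ^ p ^ n : ℤ_[p]ˣ) : ℤ_[p])) ^ (p - 1)) = 1 := by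
    rw [toZModPow_eq_one_iff_norm_sub_one_le, PadicInt.norm_def, PadicInt.coe_sub, PadicInt.coe_pow, Units.val_pow_eq_pow_val,
      PadicInt.coe_pow, PadicInt.coe_one, ← pow_mul, mul_comm (p ^ n) (p - 1), pow_mul, norm_sub_rev,
      norm_one_sub_pow_eq hp2 hy, hd', Nat.cast_pow, Padic.norm_p_pow, ← zpow_add₀ hp0'.ne']
    apply le_of_eq
    congr 1
    push_cast
    ring
  set qu : (v.adicCompletion ℚ)ˣ := Units.mk0 q hq0 with hqu_def
  have hmem : qu ^ p ^ n ∈ (Units.map (Algebra.norm (v.adicCompletion ℚ) :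
      IntermediateField.fixedField (localSubgroup (κ.layerSubgroup (n + w)) (v.adicCompletion ℚ)) →*
        v.adicCompletion ℚ)).range := by
    rw [mem_range_norm_fixedField_layer_iff_odd hp2 hκ v hv (n + w) e]
    refine ⟨((k' * p ^ n : ℕ) : ℤ), u ^ p ^ n, hcong, ?_⟩
    rw [hqu_def, Units.val_pow_eq_pow_val, Units.val_mk0, map_pow, hq, mul_pow, ← pow_mul, zpow_natCast,
      Units.val_pow_eq_pow_val, PadicInt.coe_pow]
  obtain ⟨x, hxw, hNx⟩ := exists_prod_smul_eq_of_pow_mem_range_norm hκ v hv n w hgn hug qu hmem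
  rw [hqu_def, Units.val_mk0] at hNx
  exact pow_le_natCard_localTowerKerPrimary_of_prod_smul_eq hκ v hv W hsurj hker hequiv' hQfix hQ0 hQtor n hgn hgen w
    hxw hNx

/-- **`#𝒦_{v,n}[p^∞] = p^w` EXACTLY at a split multiplicative odd `p` with `ord_p(log_p q_E) = w + 1`, every layer**
(Greenberg's `|ker(r_{v_n})| ∼ log_p(q_E)/(2p)` over the tower of `ℚ`, LNM 1716 p. 93, KERNEL).
[cite: GreenbergLNM1716, §3, between Prop. 3.6 and Prop. 3.7 (PDF pp. 92–93)] -/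
theorem finite_and_natCard_localTowerKerPrimary_eq_pow_splitOdd (hp2 : p ≠ 2) (W : WeierstrassCurve ℚ) [W.IsElliptic]
    (Dq : TateParameterData W p) (hlog : padicLog p Dq.q ≠ 0) {w : ℕ}
    (hw : (padicLog p Dq.q).valuation = (w : ℤ) + 1) (κ : ZpExtension ℚ p) (hκ : κ.IsCyclotomic)
    (v : HeightOneSpectrum (𝓞 ℚ)) (hv : ((p : ℕ) : 𝓞 ℚ) ∈ v.asIdeal) (n : ℕ) :
    Finite (W.localTowerKerPrimary κ (v.adicCompletion ℚ) n) ∧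
      Nat.card (W.localTowerKerPrimary κ (v.adicCompletion ℚ) n) = p ^ w := by
  obtain ⟨hfin, hle⟩ := finite_and_natCard_localTowerKerPrimary_le_pow_splitOdd hp2 W Dq hlog hw κ hκ v hv n
  exact ⟨hfin, le_antisymm hle (pow_le_natCard_localTowerKerPrimary_splitOdd hp2 W Dq hlog hw κ hκ v hv n)⟩

/-- **The odd-`p` clause of the named fact `Greenberg1999.sec3_natCard_localTowerKerPrimary_splitMultiplicative_rat`, body
verbatim**: for odd `p`, `W/ℚ` with a Tate parameter datum `Dq` at `p` and `log_p q_E ≠ 0`, the cyclotomic `κ` and `v ∋ p`,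
there is `e` with `e + ord_p(2p) = ord_p(log_p q_E)` (`ord_p(2p) = 1`, `ord_p(log_p q_E) ≥ 1`) such that at EVERY layer
`𝒦_{v,n}[p^∞]` is finite of order `p^e`. [cite: GreenbergLNM1716, §3, between Prop. 3.6 and Prop. 3.7 (PDF pp. 90–93)]
[cite: Washington1997, §13.1] -/
theorem sec3_natCard_localTowerKerPrimary_splitMultiplicative_odd (hp2 : p ≠ 2) (W : WeierstrassCurve ℚ) [W.IsElliptic]
    (Dq : TateParameterData W p) (hlog : padicLog p Dq.q ≠ 0)
    (κ : ZpExtension ℚ p) (hκ : κ.IsCyclotomic) (v : HeightOneSpectrum (𝓞 ℚ)) (hv : ((p : ℕ) : 𝓞 ℚ) ∈ v.asIdeal) :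
    ∃ e : ℕ, (e : ℤ) + (padicValNat p (2 * p) : ℤ) = (padicLog p Dq.q).valuation ∧
      ∀ n : ℕ, Finite (W.localTowerKerPrimary κ (v.adicCompletion ℚ) n) ∧
        Nat.card (W.localTowerKerPrimary κ (v.adicCompletion ℚ) n) = p ^ e := by
  have h2p : padicValNat p (2 * p) = 1 := by
    have hnd : ¬ p ∣ 2 := fun h ↦ hp2 ((Nat.prime_dvd_prime_iff_eq hp.out Nat.prime_two).mp h)
    rw [padicValNat.mul (by norm_num) hp.out.ne_zero, padicValNat.eq_zero_of_not_dvd hnd, padicValNat.self hp.out.one_lt,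
      zero_add]
  -- `ord_p(log_p q) = d ≥ 1`
  obtain ⟨k', u, hqu⟩ := exists_eq_prime_pow_mul_units_of_norm_lt_one Dq.q_ne_zero Dq.norm_q_lt_one
  obtain ⟨d, hd1, -, hval⟩ := exists_depth_of_padicLog_odd hp2 hqu hlog
  obtain ⟨w, rfl⟩ : ∃ w : ℕ, d = w + 1 := ⟨d - 1, by omega⟩
  have hw : (padicLog p Dq.q).valuation = (w : ℤ) + 1 := by rw [hval]; push_cast; ring
  refine ⟨w, by rw [h2p, hw]; push_cast; ring, fun n ↦ ?_⟩
  exact finite_and_natCard_localTowerKerPrimary_eq_pow_splitOdd hp2 W Dq hlog hw κ hκ v hv n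

/-! ### The named fact, all primes -/

/-- **Greenberg, LNM 1716 §3 (PDF pp. 90–93), the local tower kernel at a SPLIT multiplicative prime over the tower of
`ℚ` — the PRINT named fact `Greenberg1999.sec3_natCard_localTowerKerPrimary_splitMultiplicative_rat` DISCHARGED**: for
`W/ℚ` globally minimal elliptic with a Tate parameter datum at `p`, `log_p q_E ≠ 0`, the cyclotomic `κ` and `v ∋ p`, there is
`e` with `e + ord_p(2p) = ord_p(log_p q_E)` such that at every layer `𝒦_{v,n}[p^∞]` is finite of order `p^e`. `p = 2`: part 3
(`sec3_natCard_localTowerKerPrimary_splitMultiplicative_two`); odd `p`: `sec3_natCard_localTowerKerPrimary_splitMultiplicative_odd`.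
[cite: GreenbergLNM1716, §3, between Prop. 3.6 and Prop. 3.7 (PDF pp. 90–93)] [cite: Washington1997, §13.1] -/
theorem sec3_natCard_localTowerKerPrimary_splitMultiplicative_rat_allPrimes :
    Greenberg1999.sec3_natCard_localTowerKerPrimary_splitMultiplicative_rat := by
  intro W _ _ p _ Dq hlog κ hκ v hv
  by_cases hp2 : p = 2
  · subst hp2
    exact sec3_natCard_localTowerKerPrimary_splitMultiplicative_two W Dq hlog κ hκ v hv
  · exact sec3_natCard_localTowerKerPrimary_splitMultiplicative_odd hp2 W Dq hlog κ hκ v hv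

end Literature.NumberTheory.EllipticCurves.Greenberg1999.MultTowerSplitExact

end Part8

/-! ## Part 9 — the EXACT discharge(s) -/

/-- **Greenberg 1999, §3 (PDF pp. 90–93) HOLDS** — the named fact
`Literature.NumberTheory.EllipticCurves.Greenberg1999.sec3_natCard_localTowerKerPrimary_splitMultiplicative_rat` under its discharge name of
record: for `W/ℚ` globally minimal elliptic with a Tate parameter datum `Dq` at `p`, `log_p q_E ≠ 0`, the cyclotomic `κ` and `v ∋ p`, there is
`e : ℕ` with `e + ord_p(2p) = ord_p(log_p q_E)` such that for every `n` the `p`-primary local tower kernel `𝒦_{v,n}[p^∞]` is finite of order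
`p^e` — Part 8's `MultTowerSplitExact.sec3_natCard_localTowerKerPrimary_splitMultiplicative_rat_allPrimes` (`p = 2`: file 2's
`sec3_natCard_localTowerKerPrimary_splitMultiplicative_two`; odd `p`: `sec3_natCard_localTowerKerPrimary_splitMultiplicative_odd`).  Summits-side twin:
`Summit.BirchSwinnertonDyer.BirchSwinnertonDyer.Theorems.MultTowerSplitExact.sec3_natCard_localTowerKerPrimary_splitMultiplicative_rat_holds`.
[cite: GreenbergLNM1716, §3, between Prop. 3.6 and Prop. 3.7 (PDF pp. 90–93)] [cite: Washington1997, §13.1] -/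
theorem Literature.NumberTheory.EllipticCurves.Greenberg1999.sec3_natCard_localTowerKerPrimary_splitMultiplicative_rat_holds :
    Literature.NumberTheory.EllipticCurves.Greenberg1999.sec3_natCard_localTowerKerPrimary_splitMultiplicative_rat :=
  Literature.NumberTheory.EllipticCurves.Greenberg1999.MultTowerSplitExact.sec3_natCard_localTowerKerPrimary_splitMultiplicative_rat_allPrimes

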